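import Literature.NumberTheory.LFunctions.DirichletLOneRealZeroBoundEvenQuadratic
import Mathlib.Topology.Algebra.Order.Floor
import Mathlib.Analysis.Normed.Group.FunctionSeries
import HarnessLib

/-!
# Odd primitive Dirichlet characters via Louboutin's integral representation: `|L(1, χ)| ≤ ½ log q + 1.3`, and `L(β, χ) = 0 ⇒ 0 < L(1, χ) ≤ (1 − β)(log q + ½)²/8` for odd quadratic `χ` (proved)

Topic `Literature/NumberTheory/LFunctions`, namespace `Literature.NumberTheory.LFunctions.Louboutin2001`
(third file of the story `DirichletLOneHalfLogBoundEven` (even `χ`: `½ log q + 0.0231`, Louboutin's own constant)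
→ `DirichletLOneRealZeroBoundEvenQuadratic` (even quadratic `χ`: `L(β, χ) = 0 ⇒ L(1, χ) ≤ (1 − β) log² q/8`)).
Everything here is PROVED from Mathlib and the tree; no named facts; the only new notions are the odd theta
majorant `thetaMajorOdd = T₁`, the real integrals `oddMajorant = I₁`, `logMajorantOdd = Ĩ₁` and the kernel
`xiKernelOdd`. Typed by the literature-typing seat
`littype-FP2-1` (cell `parity-realchar`, D-0088 (4) row (7), conditionals column): the ODD-character
`½ log q + O(1)` input of the explicit Siegel–Tatuzawa / Hoffstein line (`SiegelTatuzawaExplicit.lean`: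
Hoffstein 1980 (14) needs `L(1, ψ) ≤ 0.589 log|dd′|` for the primitive inducer `ψ` of `χ_d χ_{d′}`, which is odd
when `dd′ < 0`), so far available in the tree only as NAMED FACTS (`ExplicitLOneUpperBounds.lean`:
`ramare2001_corollary1`, `½ log q + 0.7082…`) or in Pólya–Vinogradov quality
(`DirichletLOnePolyaVinogradovBound.lean`: `½ log q + log log q + 2`); here `½ log q + 1.3` as a KERNEL theorem
(`½·log 10¹² + 1.3 = 15.1 < 0.589·log 10¹² = 16.27`).

## Source, as printed (read first-hand: text PDF `paper:doi-10-4064-aa121-3-1`, pp. 200–206)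

S. Louboutin, *Lower bounds for relative class numbers of imaginary abelian number fields and CM-fields*,
Acta Arith. 121 (2006) 199–220 [Louboutin2006RelativeClassNumbers].

* **(1)** p. 200: «`κ₀ := 2 + γ − log(4π) = 0.046191…`, `κ₁ := 2 + γ − log π = 1.432485…`.»
  **Theorem 1** (p. 200): «Let `χ` be a primitive Dirichlet character modulo `f > 1`. (i) We have
  **(2)** `|L(1, χ)| ≤ ½ (log f + κ_χ)` where `κ_χ := κ₀` if `χ` is even, `κ₁` if `χ` is odd. (ii) Assume that
  `χ` is quadratic. Then `0 < β < 1` and `L(β, χ) = 0` imply **(3)** `0 < L(1, χ) ≤ (1 − β)/8 · log² f`.»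
* **Lemma 3** (p. 201), `A = 1` for odd `χ`: `θ(t, χ) = Σ_{n≥1} n χ(n) e^{−πn²t/f}`,
  `Λ(s, χ) = (f/π)^{(s+1)/2} Γ((s+1)/2) L(s, χ)`, «`θ(1/t, χ) = W(χ) t^A √t θ(t, χ̄)`», `|W(χ)| = 1`, and
  **(4)** `Λ(s, χ) = ∫₁^∞ {θ(t, χ) t^{(s+A)/2} + W(χ) θ(t, χ̄) t^{(1−s+A)/2}} dt/t`.
* **Proposition 5** (p. 202): **(7)** `I_A(f) := (1/2iπ) ∫_{c−i∞}^{c+i∞} (f/π)^s ζ(2s − A) Γ(s) {1/(s − (1+A)/2) + 1/(s − A/2)} ds`,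
  **(8)** `Ĩ_A(f)` (the same with `{1/(s − (1+A)/2)² − 1/(s − A/2)²}`), and (ii) **(9)** `|Λ(1, χ)| ≤ I_A(f)`,
  **(10)** «if `χ` is quadratic, then `0 < β < 1` and `L(β, χ) = 0` imply `|Λ(1, χ)| ≤ (1 − β)/2 · Ĩ_A(f)`»
  («To prove (9), we use (4) for `s = 1`, and Lemma 4»: by Lemma 4, `I₁(f) = ∫₁^∞ Σ_{n≥1} n e^{−πn²t/f} (t + t^{1/2}) dt/t`;
  p. 203: «due to the functional equation (5), we may assume that `1/2 ≤ β ≤ 1`. Fourth, for `t ≥ 1` real the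
  function `s ↦ t^{(s+A)/2−1} − t^{(1−s+A)/2−1}` increases with `s`, and is nonnegative in the range `s ≥ 1/2`»,
  whence **(11)** `2|Λ′(s, χ)| ≤ ∫₁^∞ Σ_{n≥1} n^A e^{−πn²t/f} (log t)(t^{(1+A)/2} − t^{A/2}) dt/t` for `½ ≤ s ≤ 1`).
* **Lemma 6** (pp. 203–204): «If `χ` is odd, then `(f/π) |L(1, χ)| = |Λ(1, χ)| ≤ I₁(f)` … If `χ` is odd and
  `L(β, χ) = 0` for some `β ∈ (0, 1)`, then `(f/π)|L(1, χ)| ≤ (1 − β)/2 · Ĩ₁(f)`.»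
* **Lemma 9 (15), (17)** (p. 206): «`I₁(f) = (f/2π)(log f + κ₁) − ½√f + ¼ + θ √(2ζ(3)/(π⁵f)) K₁ ≤ (f/2π)(log f + κ₁)`
  for `f ≥ 3`», «`Ĩ₁(f) = (f/4π)((log f − κ₁′)² + κ₁″) + ¼√f(log f + κ₁′) + ¼ + θK̃₁/√(π⁵f) ≤ (f/4π) log² f` for
  `f ≥ 3`» (residues of Lemma 7 and the bounds `K₁`, `K̃₁` of Lemma 8 on `ℜ(s) = −1/2`).

## What is proved, and how

In the tree's language (`DirichletLThetaRepresentation` / `DirichletThetaTransformation`: for odd `χ`,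
`ϑ₁(t, χ) = dirichletTheta 1 χ t = Σ_{n∈ℤ} χ(n) n e^{−πn²t/q} = 2θ(t, χ)`,
`ξ(s, χ) = dirichletXi χ s = (q/π)^{(s+1)/2} Γ((s+1)/2) L(s, χ) = Λ(s, χ)`, root number `rootNumber χ = W(χ)`,
transformation `dirichletTheta_transformation` (`ϑ₁(y, χ) = W(χ) y^{−3/2} ϑ₁(1/y, χ̄)`), Mellin form
`dirichletXi_eq_mellin`, `|W(χ)| = 1`: `SelbergDirichlet.norm_rootNumber`):
1. `norm_dirichletTheta_one_le`: `|ϑ₁(y, χ)| ≤ 2T₁(y/q)`, `T₁(u) = thetaMajorOdd u = Σ_{n≥1} n e^{−πn²u}`.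
2. `div_pi_mul_norm_LFunction_one_le_oddMajorant` — **Prop. 5 (9) / Lemma 6 exactly as printed**:
   `(q/π)|L(1, χ)| = |Λ(1, χ)| ≤ I₁(q) = oddMajorant q = ∫₁^∞ T₁(t/q)(1 + t^{−1/2}) dt`, from (4) at `s = 1`
   (the sibling file's `integral_rpow_mul_split` with `Θ″(x) = x ϑ₁(x, χ̄)`).
3. `oddMajorant_le` — **the substitution for Lemma 9 (15)**: instead of the contour shift (Stieltjes constant
   `γ(1)`, `ζ(3)`, the numerical integral `K₁`), the ELEMENTARY bound `I₁(q) ≤ (q/2π)(log q + 2.6)` for all real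
   `q ≥ 1`, from (a) a second-order Euler–Maclaurin majorant `T₁(u) ≤ 1/(2πu) + e^{−3/2}/4` (`u > 0`; private
   `tsum_succ_mul_exp_le`: trapezoid rule with kernel `{x}(1−{x})/2 ∈ [0, ⅛]` against `g″` for `g(x) = x e^{−ax²}`,
   whose sign changes once, at `x₀ = √(3/2a)` where `g′(x₀) = −2e^{−3/2}`), (b) the tail `T₁(v) ≤ (10/9)e^{−πv}`
   (`v ≥ 1`), (c) the antiderivative `(q/2π)(log t − 2t^{−1/2}) + c(t + 2√t)`; constant
   `2 + (π/2)e^{−3/2} + 2/9 = 2.57… ≤ 2.6` (the printed `κ₁ = 1.4325…` is NOT reached here; it IS reached in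
   the sequel `DirichletLOneHalfLogBoundOddSharp.lean`: `oddMajorant_le_sharp`, `I₁(q) ≤ (q/2π)(log q + κ₁)` for
   `q ≥ 2`, by termwise integration, the exact `γ/2 = ∫₀^∞ (e^{−x²} − e^{−x}) dx/x` and the midpoint
   Euler–Maclaurin rule — 2026-08-29).
4. `norm_LFunction_one_le_of_odd`: **`|L(1, χ)| ≤ ½ log q + 1.3`** for every odd primitive `χ` (any `q`), and
   `norm_LFunction_one_le_half_log_add_of_odd`: `≤ ½(log q + 2.6)` — a proved WEAKER-CONSTANT form of (2), odd case
   (the printed form `≤ ½(log q + κ₁)` is `norm_LFunction_one_le_half_log_add_kappaOdd` in the sequel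
   `DirichletLOneHalfLogBoundOddSharp.lean`; parity-free `½ log q + 0.7163` there: `norm_LFunction_one_le_of_isPrimitive_d4`).
5. `two_mul_dirichletXi_eq_integral_xiKernelOdd` ((4) for odd quadratic `χ`, real `σ`:
   `2Λ(σ, χ) = ∫₁^∞ (t^{(σ−1)/2} + t^{−σ/2}) ϑ₁(t, χ) dt`), `xiKernelOdd_one_sub_le` (the monotonicity step (11) at
   `A = 1`, by the mean value theorem), `norm_dirichletXi_one_of_odd` (`|Λ(1, χ)| = (q/π)|L(1, χ)|`).
6. `logMajorantOdd_le` — **the substitution for (17)**: `Ĩ₁(q) = logMajorantOdd q ≤ (q/4π)(log q + ½)²` for all real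
   `q ≥ 3` (same Euler–Maclaurin majorant, antiderivative of `(q/(2πt) + c)(log t)(1 − t^{−1/2})`, `log q ≤ 2(√q − 1)`,
   tail `log t ≤ log q + (t/q − 1)`); the printed `(f/4π) log² f` is NOT reached here (the elementary majorant loses
   `≈ 0.07 q log q`); it IS reached in the sequel `DirichletLOneHalfLogBoundOddSharp.lean`: `logMajorantOdd_le_sharp`,
   `Ĩ₁(q) ≤ (q/4π) log² q` for every real `q ≥ 3` (termwise integration, `E₁`-tail, partial sums of `T₁` — 2026-08-29).
7. `norm_LFunction_one_le_of_zero_of_odd`, `LFunction_one_re_pos_and_le_of_zero_of_odd` — **Theorem 1 (ii), odd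
   quadratic case, weaker constant**: `L(β, χ) = 0`, `0 < β < 1` ⇒ `0 < L(1, χ) ≤ (1 − β)(log q + ½)²/8`
   (Prop. 5 (10) → Lemma 6 → item 6; `β < ½` by the functional equation (5), `W(χ) = 1`:
   `PrimitiveQuadratic.rootNumber_eq_one_of_isQuadratic`). The PRINTED odd form `|L(1, χ)| ≤ (1 − β) log² q/8` is
   `norm_LFunction_one_le_of_zero_of_odd_sharp` in the sequel `DirichletLOneHalfLogBoundOddSharp.lean` (2026-08-29;
   class-number readings `classNumber_le_of_dedekindZetaCont_eq_zero_sharp` / `classNumber_le_of_realZero_explicit_v5` in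
   `ImaginaryQuadraticClassNumberHalfLogBound.lean`). The even quadratic case with the printed `log² q/8` is
   `norm_LFunction_one_le_of_zero` in `DirichletLOneRealZeroBoundEvenQuadratic`.
8. Parity-free readings for every primitive `χ ≠ 1`: `norm_LFunction_one_le_of_isPrimitive`
   (`|L(1, χ)| ≤ ½ log q + 1.3`), `norm_LFunction_one_le_of_zero_of_isPrimitive` and
   `LFunction_one_re_pos_and_le_of_zero_of_isPrimitive` (quadratic `χ`: `L(β, χ) = 0 ⇒ 0 < L(1, χ) ≤ (1 − β)(log q + ½)²/8`).

## References
* [Louboutin2006RelativeClassNumbers] S. Louboutin, Acta Arith. 121 (2006) 199–220, doi 10.4064/aa121-3-1.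
* [Louboutin2001CJM] S. Louboutin, Canad. J. Math. 53 (2001) 1194–1222 (p. 1197: the odd-character bound
  `½(log f_χ + 2 + γ − log π)` is [Lou4] = C. R. Acad. Sci. Paris 323 (1996) 443–446, not held: acq-14239).
-/

noncomputable section

open Complex Real MeasureTheory Filter Topology Set HurwitzZeta

namespace Literature.NumberTheory.LFunctions

namespace Louboutin2001

/-! ### The odd theta majorant `T₁(u) = Σ_{n≥1} n e^{−πn²u}` -/

/-- The odd theta majorant `T₁(u) = Σ_{n ≥ 1} n e^{−π n² u}` — the Gaussian majorant of Louboutin's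
`θ(t, χ) = Σ_{n≥1} n χ(n) e^{−πn²t/f}` for odd `χ` (`A = 1`), and the series summed in `I₁(f)`.
[cite: Louboutin2006RelativeClassNumbers, Lemma 3 p. 201 / (11) p. 203] -/
def thetaMajorOdd (u : ℝ) : ℝ := ∑' n : ℕ, ((n : ℝ) + 1) * rexp (-(π * ((n : ℝ) + 1) ^ 2 * u))

/-- Termwise geometric majorant: `(n+1) e^{−π(n+1)²u} ≤ e^{−πu} (n+1) (e^{−3πu})^n` (`(n+1)² ≥ 1 + 3n`). [folklore] -/
private theorem thetaMajorOdd_term_le {u : ℝ} (hu : 0 < u) (n : ℕ) :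
    ((n : ℝ) + 1) * rexp (-(π * ((n : ℝ) + 1) ^ 2 * u)) ≤
      rexp (-(π * u)) * (((n : ℝ) + 1) * rexp (-(3 * π * u)) ^ n) := by
  rw [← Real.exp_nat_mul, mul_left_comm, ← Real.exp_add]
  refine mul_le_mul_of_nonneg_left (Real.exp_le_exp.mpr ?_) (by positivity)
  have hn : (n : ℝ) ≤ (n : ℝ) ^ 2 := by exact_mod_cast Nat.le_self_pow two_ne_zero n
  have := mul_pos Real.pi_pos hu
  nlinarith [mul_le_mul_of_nonneg_left hn this.le]

/-- `Σ (n+1) s^n = 1/(1−s)²` for `0 ≤ s < 1`. [folklore] -/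
private theorem hasSum_succ_mul_geometric {s : ℝ} (hs0 : 0 ≤ s) (hs1 : s < 1) :
    HasSum (fun n : ℕ ↦ ((n : ℝ) + 1) * s ^ n) ((1 - s) ^ 2)⁻¹ := by
  have h1 : HasSum (fun n : ℕ ↦ (n : ℝ) * s ^ n) (s / (1 - s) ^ 2) :=
    hasSum_coe_mul_geometric_of_norm_lt_one (by rwa [Real.norm_eq_abs, abs_of_nonneg hs0])
  have h2 : HasSum (fun n : ℕ ↦ s ^ n) (1 - s)⁻¹ := hasSum_geometric_of_lt_one hs0 hs1
  have h1s : (1 - s) ≠ 0 := by linarith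
  convert h1.add h2 using 1
  · funext n; ring
  · field_simp; ring

/-- `e^{−3πu} < 1` for `u > 0`. [folklore] -/
private theorem exp_three_pi_lt_one {u : ℝ} (hu : 0 < u) : rexp (-(3 * π * u)) < 1 := by
  rw [Real.exp_lt_one_iff]; have := Real.pi_pos; nlinarith

/-- The terms of `T₁` are summable for `u > 0`. [folklore] -/
private theorem summable_thetaMajorOdd_term {u : ℝ} (hu : 0 < u) :
    Summable (fun n : ℕ ↦ ((n : ℝ) + 1) * rexp (-(π * ((n : ℝ) + 1) ^ 2 * u))) :=
  Summable.of_nonneg_of_le (fun n ↦ by positivity) (thetaMajorOdd_term_le hu)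
    (((hasSum_succ_mul_geometric (Real.exp_pos _).le (exp_three_pi_lt_one hu)).mul_left _).summable)

/-- `T₁(u)` is the sum of its series for `u > 0`. [cite: Louboutin2006RelativeClassNumbers, Lemma 3 p. 201] -/
theorem hasSum_thetaMajorOdd {u : ℝ} (hu : 0 < u) :
    HasSum (fun n : ℕ ↦ ((n : ℝ) + 1) * rexp (-(π * ((n : ℝ) + 1) ^ 2 * u))) (thetaMajorOdd u) :=
  (summable_thetaMajorOdd_term hu).hasSum

/-- `T₁ ≥ 0`. [cite: Louboutin2006RelativeClassNumbers, Lemma 3 p. 201] -/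
theorem thetaMajorOdd_nonneg (u : ℝ) : 0 ≤ thetaMajorOdd u :=
  tsum_nonneg fun _ ↦ by positivity

/-- Geometric bound `T₁(u) ≤ e^{−πu}/(1 − e^{−3πu})²` for `u > 0`. [folklore] -/
private theorem thetaMajorOdd_le_geom {u : ℝ} (hu : 0 < u) :
    thetaMajorOdd u ≤ rexp (-(π * u)) * ((1 - rexp (-(3 * π * u))) ^ 2)⁻¹ :=
  hasSum_le (thetaMajorOdd_term_le hu) (hasSum_thetaMajorOdd hu)
    ((hasSum_succ_mul_geometric (Real.exp_pos _).le (exp_three_pi_lt_one hu)).mul_left _)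

/-- Tail bound: `T₁(u) ≤ (10/9) e^{−πu}` for `u ≥ 1`. [folklore] -/
private theorem thetaMajorOdd_le_exp {u : ℝ} (hu : 1 ≤ u) :
    thetaMajorOdd u ≤ 10 / 9 * rexp (-(π * u)) := by
  have hu0 : 0 < u := by linarith
  refine (thetaMajorOdd_le_geom hu0).trans ?_
  rw [mul_comm]
  refine mul_le_mul_of_nonneg_right ?_ (Real.exp_pos _).le
  -- `e^{−3πu} ≤ e^{−9} ≤ 1/20`
  have hs : rexp (-(3 * π * u)) ≤ 1 / 20 := by
    have h1 : rexp (-(3 * π * u)) ≤ rexp (-9) := by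
      rw [Real.exp_le_exp]; have := Real.pi_gt_three; nlinarith
    have h2 : rexp 9 = rexp 1 ^ 9 := by rw [← Real.exp_nat_mul]; norm_num
    have h3 : (2 : ℝ) ≤ rexp 1 := by have := Real.add_one_le_exp (1 : ℝ); linarith
    have h4 : (2 : ℝ) ^ 9 ≤ rexp 1 ^ 9 := pow_le_pow_left₀ (by norm_num) h3 9
    have h5 : rexp (-9) ≤ 1 / 20 := by
      rw [Real.exp_neg, ← one_div]
      apply one_div_le_one_div_of_le (by norm_num)
      rw [h2]; linarith
    exact h1.trans h5
  have hs0 : 0 < rexp (-(3 * π * u)) := Real.exp_pos _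
  have hlow : (19 / 20 : ℝ) ^ 2 ≤ (1 - rexp (-(3 * π * u))) ^ 2 :=
    pow_le_pow_left₀ (by norm_num) (by linarith) 2
  calc ((1 - rexp (-(3 * π * u))) ^ 2)⁻¹ ≤ ((19 / 20 : ℝ) ^ 2)⁻¹ := inv_anti₀ (by norm_num) hlow
    _ ≤ 10 / 9 := by norm_num

/-- `T₁` is continuous on `(0, ∞)` (uniform convergence on `[ε, ∞)`). [folklore] -/
private theorem continuousOn_thetaMajorOdd : ContinuousOn thetaMajorOdd (Ioi 0) := by
  intro x hx
  have hx0 : 0 < x := hx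
  have hε : 0 < x / 2 := by positivity
  have hcont : ContinuousOn (fun y ↦ ∑' n : ℕ, ((n : ℝ) + 1) * rexp (-(π * ((n : ℝ) + 1) ^ 2 * y)))
      (Ici (x / 2)) := by
    refine continuousOn_tsum (fun n ↦ ?_) (summable_thetaMajorOdd_term hε) fun n y hy ↦ ?_
    · exact Continuous.continuousOn (by fun_prop)
    · have hy' : x / 2 ≤ y := hy
      rw [Real.norm_eq_abs, abs_of_nonneg (by positivity)]
      refine mul_le_mul_of_nonneg_left (Real.exp_le_exp.mpr ?_) (by positivity)
      have : 0 < π * ((n : ℝ) + 1) ^ 2 := by positivity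
      nlinarith
  exact (hcont.continuousAt (Ici_mem_nhds (by linarith))).continuousWithinAt

/-! ### Second-order Euler–Maclaurin bound: `Σ_{n≥1} n e^{−an²} ≤ 1/(2a) + e^{−3/2}/4` -/

section EulerMaclaurin

/-- `g(x) = x e^{−ax²}`. [folklore] -/
private def gEM (a x : ℝ) : ℝ := x * rexp (-(a * x ^ 2))

/-- `g′(x) = (1 − 2ax²) e^{−ax²}`. [folklore] -/
private def gEM' (a x : ℝ) : ℝ := (1 - 2 * a * x ^ 2) * rexp (-(a * x ^ 2))

/-- `g″(x) = (4a²x³ − 6ax) e^{−ax²}`. [folklore] -/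
private def gEM'' (a x : ℝ) : ℝ := (4 * a ^ 2 * x ^ 3 - 6 * a * x) * rexp (-(a * x ^ 2))

/-- The Euler–Maclaurin kernel `ρ(x) = {x}(1 − {x})/2 ∈ [0, 1/8]`. [folklore] -/
private def rho (x : ℝ) : ℝ := Int.fract x * (1 - Int.fract x) / 2

/-- `(e^{−ax²})′ = −2ax e^{−ax²}`. [folklore] -/
private theorem hasDerivAt_expNegSq (a x : ℝ) :
    HasDerivAt (fun x ↦ rexp (-(a * x ^ 2))) (-(2 * a * x) * rexp (-(a * x ^ 2))) x := by
  have h0 : HasDerivAt (fun x : ℝ ↦ a * x ^ 2) (a * (2 * x)) x := by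
    simpa using (hasDerivAt_pow 2 x).const_mul a
  have h : HasDerivAt (fun x ↦ -(a * x ^ 2)) (-(a * (2 * x))) x := h0.neg
  exact h.exp.congr_deriv (by ring)

/-- `g′` is the derivative of `g`. [folklore] -/
private theorem hasDerivAt_gEM (a x : ℝ) : HasDerivAt (gEM a) (gEM' a x) x := by
  have h := (hasDerivAt_id x).mul (hasDerivAt_expNegSq a x)
  have e : gEM' a x = 1 * rexp (-(a * x ^ 2)) + id x * (-(2 * a * x) * rexp (-(a * x ^ 2))) := by
    simp only [gEM', id]; ring
  rw [e]
  exact h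

/-- `g″` is the derivative of `g′`. [folklore] -/
private theorem hasDerivAt_gEM' (a x : ℝ) : HasDerivAt (gEM' a) (gEM'' a x) x := by
  have h0 : HasDerivAt (fun y : ℝ ↦ 2 * a * y ^ 2) (2 * a * (2 * x)) x := by
    simpa using (hasDerivAt_pow 2 x).const_mul (2 * a)
  have h1 : HasDerivAt (fun y : ℝ ↦ 1 - 2 * a * y ^ 2) (-(2 * a * (2 * x))) x := h0.const_sub 1
  have h := h1.mul (hasDerivAt_expNegSq a x)
  have e : gEM'' a x = -(2 * a * (2 * x)) * rexp (-(a * x ^ 2)) +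
      (1 - 2 * a * x ^ 2) * (-(2 * a * x) * rexp (-(a * x ^ 2))) := by
    simp only [gEM'']; ring
  rw [e]
  exact h

/-- `g` is continuous. [folklore] -/
private theorem continuous_gEM (a : ℝ) : Continuous (gEM a) := by unfold gEM; fun_prop
/-- `g′` is continuous. [folklore] -/
private theorem continuous_gEM' (a : ℝ) : Continuous (gEM' a) := by unfold gEM'; fun_prop
/-- `g″` is continuous. [folklore] -/
private theorem continuous_gEM'' (a : ℝ) : Continuous (gEM'' a) := by unfold gEM''; fun_prop

/-- `ρ` is continuous (it vanishes at the integers from both sides). [folklore] -/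
private theorem continuous_rho : Continuous rho := by
  have h : ContinuousOn (fun y : ℝ ↦ y * (1 - y) / 2) (Icc 0 1) := Continuous.continuousOn (by fun_prop)
  have := ContinuousOn.comp_fract'' h (by norm_num)
  exact this

/-- `ρ ≥ 0`. [folklore] -/
private theorem rho_nonneg (x : ℝ) : 0 ≤ rho x := by
  have h0 := Int.fract_nonneg x; have h1 := Int.fract_lt_one x
  unfold rho; nlinarith

/-- `ρ ≤ 1/8`. [folklore] -/
private theorem rho_le (x : ℝ) : rho x ≤ 1 / 8 := by
  have h0 := Int.fract_nonneg x; have h1 := Int.fract_lt_one x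
  unfold rho; nlinarith [sq_nonneg (Int.fract x - 1 / 2)]

/-- On `[m, m+1]`, `ρ(x) = (x − m)(m + 1 − x)/2`. [folklore] -/
private theorem rho_eq_of_mem (m : ℕ) {x : ℝ} (hx : x ∈ Icc (m : ℝ) (m + 1)) :
    rho x = (x - m) * (m + 1 - x) / 2 := by
  rcases eq_or_lt_of_le hx.2 with h | h
  · have : Int.fract x = 0 := by
      rw [h, show (m : ℝ) + 1 = ((m + 1 : ℕ) : ℝ) by push_cast; ring, Int.fract_natCast]
    rw [rho, this, h]; ring
  · have : Int.fract x = x - m := by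
      rw [Int.fract_eq_iff]
      refine ⟨by linarith [hx.1], by linarith, (m : ℤ), by push_cast; ring⟩
    rw [rho, this]; ring

/-- `∫₀^N g = (1 − e^{−aN²})/(2a)`. [folklore] -/
private theorem integral_gEM {a : ℝ} (ha : 0 < a) (N : ℝ) :
    ∫ x in (0 : ℝ)..N, gEM a x = (1 - rexp (-(a * N ^ 2))) / (2 * a) := by
  have ha' : a ≠ 0 := ha.ne'
  have h : ∀ x ∈ uIcc (0 : ℝ) N, HasDerivAt (fun x ↦ (-1 / (2 * a)) * rexp (-(a * x ^ 2))) (gEM a x) x := by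
    intro x _
    refine ((hasDerivAt_expNegSq a x).const_mul (-1 / (2 * a))).congr_deriv ?_
    simp only [gEM]; field_simp
  rw [intervalIntegral.integral_eq_sub_of_hasDerivAt h ((continuous_gEM a).intervalIntegrable _ _)]
  norm_num
  field_simp
  ring

/-- The trapezoid identity on `[m, m+1]` with the second-order kernel:
`(g(m) + g(m+1))/2 = ∫_m^{m+1} g + ∫_m^{m+1} ρ g″`. [folklore] -/
private theorem trapezoid_gEM (a : ℝ) (m : ℕ) :
    (gEM a m + gEM a (m + 1)) / 2 =
      (∫ x in (m : ℝ)..(m : ℝ) + 1, gEM a x) + ∫ x in (m : ℝ)..(m : ℝ) + 1, rho x * gEM'' a x := by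
  set R : ℝ → ℝ := fun x ↦ (x - m) * (m + 1 - x) / 2 with hR
  set Φ : ℝ → ℝ := fun x ↦ (x - m - 1 / 2) * gEM a x + R x * gEM' a x with hΦ
  have hderiv : ∀ x ∈ uIcc (m : ℝ) ((m : ℝ) + 1), HasDerivAt Φ (gEM a x + R x * gEM'' a x) x := by
    intro x _
    have hP : HasDerivAt (fun x : ℝ ↦ x - m - 1 / 2) 1 x := by
      simpa using ((hasDerivAt_id x).sub_const (m : ℝ)).sub_const (1 / 2 : ℝ)
    have hRd : HasDerivAt R (-(x - m - 1 / 2)) x := by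
      have h1 : HasDerivAt (fun x : ℝ ↦ x - m) 1 x := by simpa using (hasDerivAt_id x).sub_const (m : ℝ)
      have h2 : HasDerivAt (fun x : ℝ ↦ (m : ℝ) + 1 - x) (-1) x := by
        simpa using (hasDerivAt_id x).const_sub ((m : ℝ) + 1)
      have := (h1.mul h2).div_const 2
      exact this.congr_deriv (by ring)
    have := (hP.mul (hasDerivAt_gEM a x)).add (hRd.mul (hasDerivAt_gEM' a x))
    exact this.congr_deriv (by ring)
  have hcont : Continuous (fun x ↦ gEM a x + R x * gEM'' a x) := by
    simp only [hR]; exact (continuous_gEM a).add ((by fun_prop : Continuous R).mul (continuous_gEM'' a))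
  have hFTC := intervalIntegral.integral_eq_sub_of_hasDerivAt hderiv (hcont.intervalIntegrable _ _)
  have hRm : R m = 0 := by simp [hR]
  have hRm1 : R (m + 1) = 0 := by simp [hR]
  have hval : Φ ((m : ℝ) + 1) - Φ m = (gEM a m + gEM a (m + 1)) / 2 := by
    simp only [hΦ, hRm, hRm1]; ring
  have hRI : IntervalIntegrable (fun x ↦ R x * gEM'' a x) volume (m : ℝ) ((m : ℝ) + 1) :=
    (((by fun_prop : Continuous R).mul (continuous_gEM'' a)).intervalIntegrable _ _)
  rw [← hval, ← hFTC, intervalIntegral.integral_add ((continuous_gEM a).intervalIntegrable _ _) hRI]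
  congr 1
  refine intervalIntegral.integral_congr fun x hx ↦ ?_
  rw [uIcc_of_le (by linarith)] at hx
  simp only [hR]
  rw [rho_eq_of_mem m hx]

/-- Partial sums: `Σ_{m<N} g(m+1) = ∫₀^N g + g(N)/2 + ∫₀^N ρ g″`. [folklore] -/
private theorem partialSum_gEM (a : ℝ) (N : ℕ) :
    ∑ m ∈ Finset.range N, gEM a (m + 1) =
      (∫ x in (0 : ℝ)..N, gEM a x) + gEM a N / 2 + ∫ x in (0 : ℝ)..N, rho x * gEM'' a x := by
  have hsum : ∑ m ∈ Finset.range N, (gEM a m + gEM a (m + 1)) / 2 =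
      (∫ x in (0 : ℝ)..N, gEM a x) + ∫ x in (0 : ℝ)..N, rho x * gEM'' a x := by
    simp_rw [trapezoid_gEM a]
    rw [Finset.sum_add_distrib]
    have e1 := intervalIntegral.sum_integral_adjacent_intervals (a := fun k : ℕ ↦ (k : ℝ)) (n := N)
      (f := gEM a) (μ := volume) fun k _ ↦ (continuous_gEM a).intervalIntegrable _ _
    have e2 := intervalIntegral.sum_integral_adjacent_intervals (a := fun k : ℕ ↦ (k : ℝ)) (n := N)
      (f := fun x ↦ rho x * gEM'' a x) (μ := volume)
      fun k _ ↦ (continuous_rho.mul (continuous_gEM'' a)).intervalIntegrable _ _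
    simp only [Nat.cast_add, Nat.cast_one, Nat.cast_zero] at e1 e2
    rw [e1, e2]
  have hshift : ∑ m ∈ Finset.range N, gEM a m = (∑ m ∈ Finset.range N, gEM a (m + 1)) - gEM a N := by
    have h1 : ∑ m ∈ Finset.range (N + 1), gEM a m = (∑ m ∈ Finset.range N, gEM a (m + 1)) + gEM a 0 := by
      rw [Finset.sum_range_succ']; push_cast; rfl
    have h2 : ∑ m ∈ Finset.range (N + 1), gEM a m = (∑ m ∈ Finset.range N, gEM a m) + gEM a N :=
      Finset.sum_range_succ _ _
    have h0 : gEM a 0 = 0 := by simp [gEM]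
    linarith
  have hsum' : ∑ m ∈ Finset.range N, (gEM a m + gEM a (m + 1)) / 2 =
      ((∑ m ∈ Finset.range N, gEM a m) + ∑ m ∈ Finset.range N, gEM a (m + 1)) / 2 := by
    rw [← Finset.sum_add_distrib, Finset.sum_div]
  rw [hsum', hshift] at hsum
  linarith

/-- `∫₀^N ρ g″ ≤ e^{−3/2}/4`: `ρ g″ ≤ 0` where `g″ ≤ 0` (`x ≤ x₀ = √(3/2a)`), `ρ g″ ≤ g″/8` beyond, and
`−g′(x₀) = 2e^{−3/2}`. [folklore] -/
private theorem integral_rho_gEM''_le {a : ℝ} (ha : 0 < a) (N : ℕ) :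
    ∫ x in (0 : ℝ)..N, rho x * gEM'' a x ≤ rexp (-(3 / 2)) / 4 := by
  set x₀ : ℝ := Real.sqrt (3 / (2 * a)) with hx₀
  have hx₀0 : 0 ≤ x₀ := Real.sqrt_nonneg _
  have hx₀sq : x₀ ^ 2 = 3 / (2 * a) := Real.sq_sqrt (by positivity)
  have hax₀ : a * x₀ ^ 2 = 3 / 2 := by rw [hx₀sq]; field_simp
  have hc : 0 < rexp (-(3 / 2)) / 4 := by positivity
  -- sign of `g″`
  have hneg : ∀ x, 0 ≤ x → x ≤ x₀ → gEM'' a x ≤ 0 := by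
    intro x hx hxx
    have h1 : x ^ 2 ≤ x₀ ^ 2 := pow_le_pow_left₀ hx hxx 2
    have h2 : 2 * a * x ^ 2 ≤ 3 := by nlinarith
    have h3 : 4 * a ^ 2 * x ^ 3 - 6 * a * x = 2 * a * x * (2 * a * x ^ 2 - 3) := by ring
    unfold gEM''
    rw [h3]
    exact mul_nonpos_of_nonpos_of_nonneg (mul_nonpos_of_nonneg_of_nonpos (by positivity) (by linarith))
      (Real.exp_pos _).le
  have hpos : ∀ x, x₀ ≤ x → 0 ≤ gEM'' a x := by
    intro x hxx
    have hx : 0 ≤ x := hx₀0.trans hxx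
    have h1 : x₀ ^ 2 ≤ x ^ 2 := pow_le_pow_left₀ hx₀0 hxx 2
    have h2 : 3 ≤ 2 * a * x ^ 2 := by nlinarith
    have h3 : 4 * a ^ 2 * x ^ 3 - 6 * a * x = 2 * a * x * (2 * a * x ^ 2 - 3) := by ring
    unfold gEM''
    rw [h3]
    exact mul_nonneg (mul_nonneg (by positivity) (by linarith)) (Real.exp_pos _).le
  have hg'neg : ∀ y, x₀ ≤ y → gEM' a y ≤ 0 := by
    intro y hy
    have h1 : x₀ ^ 2 ≤ y ^ 2 := pow_le_pow_left₀ hx₀0 hy 2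
    have h2 : 3 ≤ 2 * a * y ^ 2 := by nlinarith
    unfold gEM'
    exact mul_nonpos_of_nonpos_of_nonneg (by linarith) (Real.exp_pos _).le
  have hg'x₀ : gEM' a x₀ = -2 * rexp (-(3 / 2)) := by
    have h3 : 2 * a * x₀ ^ 2 = 3 := by linarith [hax₀]
    unfold gEM'; rw [h3, hax₀]; ring
  have hint : ∀ b c : ℝ, IntervalIntegrable (fun x ↦ rho x * gEM'' a x) volume b c :=
    fun b c ↦ (continuous_rho.mul (continuous_gEM'' a)).intervalIntegrable _ _
  -- the part where the integrand is nonpositive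
  have hle0 : ∀ y, 0 ≤ y → y ≤ x₀ → ∫ x in (0 : ℝ)..y, rho x * gEM'' a x ≤ 0 := by
    intro y hy hyx
    have := intervalIntegral.integral_mono_on (hab := hy) (hf := hint 0 y)
      (hg := intervalIntegrable_const)
      (fun x hx ↦ mul_nonpos_of_nonneg_of_nonpos (rho_nonneg x) (hneg x hx.1 (hx.2.trans hyx)))
    simpa using this
  by_cases hN : (N : ℝ) ≤ x₀
  · exact (hle0 N N.cast_nonneg hN).trans hc.le
  · push Not at hN
    rw [← intervalIntegral.integral_add_adjacent_intervals (hint 0 x₀) (hint x₀ N)]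
    have hgI : IntervalIntegrable (fun x ↦ 1 / 8 * gEM'' a x) volume x₀ N :=
      (continuous_const.mul (continuous_gEM'' a)).intervalIntegrable _ _
    have h2 : ∫ x in x₀..(N : ℝ), rho x * gEM'' a x ≤ ∫ x in x₀..(N : ℝ), 1 / 8 * gEM'' a x := by
      refine intervalIntegral.integral_mono_on (hab := hN.le) (hf := hint x₀ N) (hg := hgI) fun x hx ↦ ?_
      exact mul_le_mul_of_nonneg_right (rho_le x) (hpos x hx.1)
    have h3 : ∫ x in x₀..(N : ℝ), 1 / 8 * gEM'' a x = 1 / 8 * (gEM' a N - gEM' a x₀) := by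
      rw [intervalIntegral.integral_const_mul,
        intervalIntegral.integral_eq_sub_of_hasDerivAt (fun x _ ↦ hasDerivAt_gEM' a x)
          ((continuous_gEM'' a).intervalIntegrable _ _)]
    have h4 := hg'neg N hN.le
    have h1 := hle0 x₀ hx₀0 le_rfl
    rw [h3, hg'x₀] at h2
    linarith

/-- **`Σ_{n≥1} n e^{−an²} ≤ 1/(2a) + e^{−3/2}/4`** for `a > 0` (second-order Euler–Maclaurin). [folklore] -/
private theorem tsum_succ_mul_exp_le {a : ℝ} (ha : 0 < a) :
    ∑' n : ℕ, ((n : ℝ) + 1) * rexp (-(a * ((n : ℝ) + 1) ^ 2)) ≤ 1 / (2 * a) + rexp (-(3 / 2)) / 4 := by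
  set C : ℝ := 1 / (2 * a) + rexp (-(3 / 2)) / 4 with hC
  -- uniform bound on the partial sums
  have hS : ∀ N : ℕ, ∑ m ∈ Finset.range N, gEM a (m + 1) ≤ C + 1 / (2 * a) / N := by
    intro N
    rw [partialSum_gEM, integral_gEM ha]
    have i1 : (1 - rexp (-(a * (N : ℝ) ^ 2))) / (2 * a) ≤ 1 / (2 * a) :=
      div_le_div_of_nonneg_right (by linarith [Real.exp_pos (-(a * (N : ℝ) ^ 2))]) (by positivity)
    have i2 := integral_rho_gEM''_le ha N
    have i3 : gEM a N / 2 ≤ 1 / (2 * a) / N := by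
      rcases Nat.eq_zero_or_pos N with h | h
      · subst h; simp [gEM]
      · have hN : (0 : ℝ) < N := by exact_mod_cast h
        have he : a * (N : ℝ) ^ 2 + 1 ≤ rexp (a * (N : ℝ) ^ 2) := Real.add_one_le_exp _
        have h1 : rexp (-(a * (N : ℝ) ^ 2)) ≤ 1 / (a * (N : ℝ) ^ 2) := by
          rw [Real.exp_neg, ← one_div]
          exact one_div_le_one_div_of_le (by positivity) (by linarith)
        have h2 : gEM a N ≤ 1 / (a * N) := by
          unfold gEM
          calc (N : ℝ) * rexp (-(a * (N : ℝ) ^ 2)) ≤ (N : ℝ) * (1 / (a * (N : ℝ) ^ 2)) :=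
                mul_le_mul_of_nonneg_left h1 hN.le
            _ = 1 / (a * N) := by field_simp
        rw [show 1 / (2 * a) / (N : ℝ) = (1 / (a * N)) / 2 by field_simp]
        linarith
    linarith
  have hsum := summable_thetaMajorOdd_term (u := a / π) (by positivity)
  have hterm : (fun n : ℕ ↦ ((n : ℝ) + 1) * rexp (-(π * ((n : ℝ) + 1) ^ 2 * (a / π)))) =
      fun n : ℕ ↦ gEM a (n + 1) := by
    funext n
    have e : π * ((n : ℝ) + 1) ^ 2 * (a / π) = a * ((n : ℝ) + 1) ^ 2 := by field_simp
    simp only [gEM, e]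
  rw [hterm] at hsum
  have h1 := hsum.hasSum.tendsto_sum_nat
  have h2 : Tendsto (fun N : ℕ ↦ C + 1 / (2 * a) / N) atTop (𝓝 (C + 0)) :=
    tendsto_const_nhds.add (tendsto_const_div_atTop_nhds_zero_nat _)
  rw [add_zero] at h2
  have := le_of_tendsto_of_tendsto' h1 h2 hS
  simpa [gEM] using this

end EulerMaclaurin

/-- **`T₁(u) ≤ 1/(2πu) + e^{−3/2}/4`** for `u > 0` — the elementary substitute for the residue
`Res_{s=1}((f/π)^s ζ(2s−1)Γ(s)) ` (leading term `1/(2πu)` of `Σ n e^{−πn²u}`). [folklore] -/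
private theorem thetaMajorOdd_le_main {u : ℝ} (hu : 0 < u) :
    thetaMajorOdd u ≤ 1 / (2 * π * u) + rexp (-(3 / 2)) / 4 := by
  have h := tsum_succ_mul_exp_le (a := π * u) (by positivity)
  have e : thetaMajorOdd u = ∑' n : ℕ, ((n : ℝ) + 1) * rexp (-(π * u * ((n : ℝ) + 1) ^ 2)) := by
    unfold thetaMajorOdd; refine tsum_congr fun n ↦ ?_; ring_nf
  rw [e, show 2 * π * u = 2 * (π * u) by ring]
  exact h


/-! ### `I₁(q) = ∫₁^∞ T₁(t/q)(1 + t^{−1/2}) dt ≤ (q/2π)(log q + 2.6)` -/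

/-- Louboutin's `I₁(f)` ((7)–(8) with `A = 1`, on the real line by Lemma 4 — the right-hand side of (11) without
the logarithm): `I₁(q) = ∫₁^∞ T₁(t/q) (1 + t^{−1/2}) dt`. [cite: Louboutin2006RelativeClassNumbers, (7) p. 202] -/
def oddMajorant (q : ℝ) : ℝ := ∫ t in Ioi (1 : ℝ), thetaMajorOdd (t / q) * (1 + (Real.sqrt t)⁻¹)

/-- `t ↦ T₁(t/Q) g(t)` is integrable on `(1, ∞)` for `Q ≥ 1`, `g` continuous on `(0, ∞)` and bounded on
`(1, ∞)` (compact part + exponential tail). [folklore] -/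
private theorem integrableOn_thetaMajorOdd_div_mul {Q : ℝ} (hQ : 1 ≤ Q) {g : ℝ → ℝ} {B : ℝ}
    (hg : ContinuousOn g (Ioi 0)) (hB : ∀ t, 1 < t → |g t| ≤ B) :
    IntegrableOn (fun t ↦ thetaMajorOdd (t / Q) * g t) (Ioi 1) := by
  have hQ0 : 0 < Q := by linarith
  have hcont : ContinuousOn (fun t ↦ thetaMajorOdd (t / Q) * g t) (Ioi 0) := by
    refine ContinuousOn.mul ?_ hg
    exact continuousOn_thetaMajorOdd.comp (continuousOn_id.div_const Q)
      fun t (ht : (0 : ℝ) < t) ↦ div_pos ht hQ0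
  rw [← Ioc_union_Ioi_eq_Ioi hQ]
  refine IntegrableOn.union ?_ ?_
  · exact ((hcont.mono fun t ht ↦ (lt_of_lt_of_le one_pos ht.1 : (0 : ℝ) < t)).integrableOn_compact
      isCompact_Icc).mono_set Ioc_subset_Icc_self
  · have hdom : IntegrableOn (fun t ↦ 10 / 9 * B * rexp (-(π / Q) * t)) (Ioi Q) :=
      (exp_neg_integrableOn_Ioi Q (by positivity : 0 < π / Q)).const_mul (10 / 9 * B)
    refine Integrable.mono' hdom
      ((hcont.mono fun t (ht : Q < t) ↦ (hQ0.trans ht : (0 : ℝ) < t)).aestronglyMeasurable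
        measurableSet_Ioi) ?_
    refine (ae_restrict_iff' measurableSet_Ioi).mpr (ae_of_all _ fun t (ht : Q < t) ↦ ?_)
    have ht1 : 1 < t := lt_of_le_of_lt hQ ht
    have htQ : 1 ≤ t / Q := by rw [le_div_iff₀ hQ0]; linarith
    rw [norm_mul, Real.norm_eq_abs, Real.norm_eq_abs, abs_of_nonneg (thetaMajorOdd_nonneg _)]
    have h1 := thetaMajorOdd_le_exp htQ
    have h2 := hB t ht1
    have e : rexp (-(π * (t / Q))) = rexp (-(π / Q) * t) := by congr 1; ring
    calc thetaMajorOdd (t / Q) * |g t| ≤ (10 / 9 * rexp (-(π * (t / Q)))) * B :=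
          mul_le_mul h1 h2 (abs_nonneg _) (by positivity)
      _ = 10 / 9 * B * rexp (-(π / Q) * t) := by rw [e]; ring

/-- The elementary antiderivative of `(q/(2πt) + c)(1 + t^{−1/2})`. [folklore] -/
private theorem hasDerivAt_oddAnti (q c : ℝ) {t : ℝ} (ht : 0 < t) :
    HasDerivAt (fun t ↦ q / (2 * π) * (Real.log t - 2 * (Real.sqrt t)⁻¹) + c * (t + 2 * Real.sqrt t))
      ((q / (2 * π * t) + c) * (1 + (Real.sqrt t)⁻¹)) t := by
  have hst : 0 < Real.sqrt t := Real.sqrt_pos.mpr ht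
  have h1 : HasDerivAt Real.log t⁻¹ t := Real.hasDerivAt_log ht.ne'
  have h2 : HasDerivAt Real.sqrt (1 / (2 * Real.sqrt t)) t := Real.hasDerivAt_sqrt ht.ne'
  have h3 : HasDerivAt (fun t ↦ (Real.sqrt t)⁻¹) (-(1 / (2 * Real.sqrt t)) / Real.sqrt t ^ 2) t :=
    h2.inv hst.ne'
  have hA := ((h1.sub (h3.const_mul 2)).const_mul (q / (2 * π))).add
    (((hasDerivAt_id t).add (h2.const_mul 2)).const_mul c)
  refine hA.congr_deriv ?_
  have hsq : Real.sqrt t ^ 2 = t := Real.sq_sqrt ht.le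
  rw [hsq]
  field_simp
  ring

/-- `e^{−3/2} ≤ 0.2235`. [folklore] -/
private theorem exp_neg_three_halves_le : rexp (-(3 / 2)) ≤ 0.2235 := by
  have h1 : rexp (3 / 2) = rexp 1 * rexp (1 / 2) := by rw [← Real.exp_add]; norm_num
  have h2 : rexp (1 / 2) ^ 2 = rexp 1 := by rw [← Real.exp_nat_mul]; norm_num
  have h3 := Real.exp_one_gt_d9
  have h0 : 0 < rexp (1 / 2) := Real.exp_pos _
  have h4 : 1.648 < rexp (1 / 2) := by nlinarith
  have h5 : 4.475 < rexp (3 / 2) := by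
    rw [h1]; nlinarith [mul_lt_mul'' h3 h4 (by norm_num) (by norm_num)]
  have h6 := one_div_le_one_div_of_le (by norm_num : (0 : ℝ) < 4.475) h5.le
  rw [Real.exp_neg, inv_eq_one_div]
  have : (1 : ℝ) / 4.475 ≤ 0.2235 := by norm_num
  linarith

/-- `e^{−π} ≤ 1/20`. [folklore] -/
private theorem exp_neg_pi_le : rexp (-π) ≤ 1 / 20 := by
  have h1 : rexp (-π) ≤ rexp (-3) := Real.exp_le_exp.mpr (by linarith [Real.pi_gt_three])
  have h2 : rexp 3 = rexp 1 ^ 3 := by rw [← Real.exp_nat_mul]; norm_num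
  have h3 := Real.exp_one_gt_d9
  have h4 : (2.7182818283 : ℝ) ^ 3 < rexp 1 ^ 3 := pow_lt_pow_left₀ h3 (by norm_num) (by norm_num)
  have h5 : (20 : ℝ) ≤ rexp 3 := by rw [h2]; nlinarith
  have h6 : rexp (-3) ≤ 1 / 20 := by
    rw [Real.exp_neg, inv_eq_one_div]
    exact one_div_le_one_div_of_le (by norm_num) h5
  exact h1.trans h6

/-- **`I₁(q) ≤ (q/2π)(log q + 2.6)`** for every real `q ≥ 1` — an elementary (weaker-constant) substitute for
Louboutin's **(15)** `I₁(f) = (f/2π)(log f + κ₁) − ½√f + ¼ + θ√(2ζ(3)/(π⁵f)) K₁ ≤ (f/2π)(log f + κ₁)` (`f ≥ 3`,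
`κ₁ = 2 + γ − log π = 1.4325…`, by the contour shift to `ℜ(s) = −1/2`): the Euler–Maclaurin majorant
`T₁(u) ≤ 1/(2πu) + e^{−3/2}/4` and the tail `T₁(v) ≤ (10/9)e^{−πv}` (`v ≥ 1`) give the constant
`2 + (π/2)e^{−3/2} + 2/9 = 2.57… ≤ 2.6`. [cite: Louboutin2006RelativeClassNumbers, Lemma 9 (15) p. 206] -/
theorem oddMajorant_le {q : ℝ} (hq : 1 ≤ q) :
    oddMajorant q ≤ q / (2 * π) * (Real.log q + 2.6) := by
  have hq0 : 0 < q := by linarith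
  have hπ0 := Real.pi_pos
  unfold oddMajorant
  set c₀ : ℝ := rexp (-(3 / 2)) / 4 with hc₀
  set F : ℝ → ℝ := fun t ↦ thetaMajorOdd (t / q) * (1 + (Real.sqrt t)⁻¹) with hF
  have hwcont : ContinuousOn (fun t : ℝ ↦ 1 + (Real.sqrt t)⁻¹) (Ioi 0) :=
    continuousOn_const.add ((Real.continuous_sqrt.continuousOn).inv₀
      fun x (hx : (0 : ℝ) < x) ↦ (Real.sqrt_pos.mpr hx).ne')
  have hwbd : ∀ t, 1 < t → |1 + (Real.sqrt t)⁻¹| ≤ 2 := by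
    intro t ht
    have hst1 : 1 ≤ Real.sqrt t := Real.one_le_sqrt.mpr ht.le
    have : (Real.sqrt t)⁻¹ ≤ 1 := inv_le_one_of_one_le₀ hst1
    rw [abs_of_nonneg (by positivity)]; linarith
  have hFint : IntegrableOn F (Ioi 1) := integrableOn_thetaMajorOdd_div_mul hq hwcont hwbd
  -- split `(1, ∞) = (1, q] ∪ (q, ∞)`
  have hsplit : Ioi (1 : ℝ) = Ioc 1 q ∪ Ioi q := (Ioc_union_Ioi_eq_Ioi hq).symm
  have hdisj : Disjoint (Ioc (1 : ℝ) q) (Ioi q) :=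
    Set.disjoint_left.mpr fun x hx hx' ↦ (not_lt.mpr hx.2) hx'
  have e0 : ∫ t in Ioi 1, F t = (∫ t in Ioc 1 q, F t) + ∫ t in Ioi q, F t := by
    rw [hsplit]
    exact setIntegral_union hdisj measurableSet_Ioi (hFint.mono_set Ioc_subset_Ioi_self)
      (hFint.mono_set (Ioi_subset_Ioi hq))
  -- piece over `(1, q]`
  have hmain : ∀ t, 0 < t → thetaMajorOdd (t / q) ≤ q / (2 * π * t) + c₀ := by
    intro t ht
    have h := thetaMajorOdd_le_main (div_pos ht hq0)
    have e : 1 / (2 * π * (t / q)) = q / (2 * π * t) := by field_simp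
    rwa [e] at h
  have p1 : ∫ t in Ioc 1 q, F t ≤
      q / (2 * π) * (Real.log q - 2 * (Real.sqrt q)⁻¹ + 2) + c₀ * (q + 2 * Real.sqrt q - 3) := by
    rw [← intervalIntegral.integral_of_le hq]
    have hG : ∀ t ∈ uIcc 1 q, HasDerivAt
        (fun t ↦ q / (2 * π) * (Real.log t - 2 * (Real.sqrt t)⁻¹) + c₀ * (t + 2 * Real.sqrt t))
        ((q / (2 * π * t) + c₀) * (1 + (Real.sqrt t)⁻¹)) t := by
      intro t ht; rw [uIcc_of_le hq] at ht; exact hasDerivAt_oddAnti q c₀ (by linarith [ht.1])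
    have hGcont : ContinuousOn (fun t ↦ (q / (2 * π * t) + c₀) * (1 + (Real.sqrt t)⁻¹)) (uIcc 1 q) := by
      rw [uIcc_of_le hq]
      have hsub : Icc 1 q ⊆ Ioi (0 : ℝ) := fun t ht ↦ (lt_of_lt_of_le one_pos ht.1 : (0 : ℝ) < t)
      refine ContinuousOn.mul ?_ (hwcont.mono hsub)
      refine ContinuousOn.add ?_ continuousOn_const
      refine continuousOn_const.div (continuousOn_const.mul continuousOn_id) fun t ht ↦ ?_
      have : (0 : ℝ) < t := hsub ht
      positivity
    have hFI : IntervalIntegrable F volume 1 q :=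
      (intervalIntegrable_iff_integrableOn_Ioc_of_le hq).mpr (hFint.mono_set Ioc_subset_Ioi_self)
    have hle : ∫ t in (1 : ℝ)..q, F t ≤ ∫ t in (1 : ℝ)..q, (q / (2 * π * t) + c₀) * (1 + (Real.sqrt t)⁻¹) := by
      refine intervalIntegral.integral_mono_on (hab := hq) (hf := hFI) (hg := hGcont.intervalIntegrable)
        fun t ht ↦ ?_
      exact mul_le_mul_of_nonneg_right (hmain t (by linarith [ht.1])) (by positivity)
    rw [intervalIntegral.integral_eq_sub_of_hasDerivAt hG hGcont.intervalIntegrable] at hle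
    simp only [Real.log_one, Real.sqrt_one, inv_one] at hle
    linarith
  -- piece over `(q, ∞)`
  have p2 : ∫ t in Ioi q, F t ≤ 20 / 9 * (q / π * rexp (-π)) := by
    have hdom : IntegrableOn (fun t ↦ 20 / 9 * rexp (-(π / q) * t)) (Ioi q) :=
      (exp_neg_integrableOn_Ioi q (by positivity : 0 < π / q)).const_mul _
    have hle : ∫ t in Ioi q, F t ≤ ∫ t in Ioi q, 20 / 9 * rexp (-(π / q) * t) := by
      refine setIntegral_mono_on (hFint.mono_set (Ioi_subset_Ioi hq)) hdom measurableSet_Ioi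
        fun t (ht : q < t) ↦ ?_
      have htq : 1 ≤ t / q := by rw [le_div_iff₀ hq0]; linarith
      have h1 := thetaMajorOdd_le_exp htq
      have h2 := hwbd t (lt_of_le_of_lt hq ht)
      rw [abs_of_nonneg (by positivity)] at h2
      have e : rexp (-(π * (t / q))) = rexp (-(π / q) * t) := by congr 1; ring
      calc F t = thetaMajorOdd (t / q) * (1 + (Real.sqrt t)⁻¹) := rfl
        _ ≤ (10 / 9 * rexp (-(π * (t / q)))) * 2 := mul_le_mul h1 h2 (by positivity) (by positivity)
        _ = 20 / 9 * rexp (-(π / q) * t) := by rw [e]; ring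
    have hval : ∫ t in Ioi q, 20 / 9 * rexp (-(π / q) * t) = 20 / 9 * (q / π * rexp (-π)) := by
      have hneg : -(π / q) < 0 := neg_lt_zero.mpr (by positivity)
      rw [integral_const_mul, integral_exp_mul_Ioi hneg q]
      congr 1
      have : -(π / q) * q = -π := by field_simp
      rw [this]
      field_simp
    linarith
  -- numerics
  have hc0 : c₀ ≤ 0.055875 := by have := exp_neg_three_halves_le; rw [hc₀]; linarith
  have hc0' : 0 ≤ c₀ := by positivity
  have heπ : rexp (-π) ≤ 1 / 20 := exp_neg_pi_le
  have hsq1 : 1 ≤ Real.sqrt q := Real.one_le_sqrt.mpr hq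
  have hsq : Real.sqrt q * Real.sqrt q = q := Real.mul_self_sqrt hq0.le
  have hπinv : 0.318 ≤ 1 / π := by
    rw [le_div_iff₀ hπ0]; nlinarith [Real.pi_lt_d4]
  have g1 : q / (2 * π) * (Real.log q - 2 * (Real.sqrt q)⁻¹ + 2) =
      q / (2 * π) * Real.log q - Real.sqrt q * (1 / π) + q * (1 / π) := by
    have hs0 : Real.sqrt q ≠ 0 := by positivity
    field_simp
    nlinarith [hsq]
  have f1 : c₀ * q ≤ 0.055875 * q := mul_le_mul_of_nonneg_right hc0 hq0.le
  have f2 : c₀ * Real.sqrt q ≤ 0.055875 * Real.sqrt q := mul_le_mul_of_nonneg_right hc0 (by positivity)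
  have f3 : q / π * rexp (-π) ≤ q / π * (1 / 20) := mul_le_mul_of_nonneg_left heπ (by positivity)
  have f4 : 0.318 * q ≤ q * (1 / π) := by nlinarith
  have f5 : 0.318 * Real.sqrt q ≤ Real.sqrt q * (1 / π) := by nlinarith
  have e1 : q / π = q * (1 / π) := by ring
  have e2 : q / (2 * π) * (Real.log q + 2.6) = q / (2 * π) * Real.log q + 1.3 * (q * (1 / π)) := by ring
  rw [e0, e2]
  rw [e1] at f3 p2
  nlinarith [p1, p2, f1, f2, f3, f4, f5, g1]

/-! ### Odd primitive characters: `(q/π)|L(1, χ)| = |Λ(1, χ)| ≤ I₁(q)` and the bound -/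


section Dirichlet

open DirichletCharacter DirichletTheta

variable {q : ℕ} [NeZero q] {χ : DirichletCharacter ℂ q}

omit [NeZero q] in
/-- An odd character is non-principal. [folklore] -/
private theorem ne_one_of_odd' (hodd : χ.Odd) : χ ≠ 1 := by
  rintro rfl
  have h : (1 : DirichletCharacter ℂ q) (-1) = -1 := hodd
  rw [MulChar.one_apply (isUnit_one.neg)] at h
  norm_num at h

/-- The Gaussian majorant of the theta series of an odd character:
`|ϑ₁(y, χ)| ≤ 2 Σ_{n≥1} n e^{−πn²y/q} = 2T₁(y/q)` (`y > 0`). [cite: Louboutin2006RelativeClassNumbers, (11) p. 203] -/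
theorem norm_dirichletTheta_one_le (hodd : χ.Odd) {y : ℝ} (hy : 0 < y) :
    ‖dirichletTheta 1 χ y‖ ≤ 2 * thetaMajorOdd (y / q) := by
  have hχ : χ ≠ 1 := ne_one_of_odd' hodd
  have hq : q ≠ 1 := by rintro rfl; exact hχ χ.level_one
  have hq0 : (0 : ℝ) < q := by exact_mod_cast NeZero.pos q
  have hpar : χ (-1) = (-1) ^ (1 : ℕ) := by rw [pow_one]; exact hodd
  have h := hasSum_nat_dirichletTheta hpar hq hy
  have hT := (hasSum_thetaMajorOdd (div_pos hy hq0)).mul_left 2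
  rw [← h.tsum_eq]
  refine tsum_of_norm_bounded hT fun n ↦ ?_
  rw [norm_mul, Complex.norm_ofNat]
  refine mul_le_mul_of_nonneg_left ?_ zero_le_two
  unfold thetaTerm
  rw [norm_mul, norm_mul, pow_one, Complex.norm_intCast, Complex.norm_real, Real.norm_eq_abs,
    abs_of_nonneg (Real.exp_pos _).le]
  have h1 : ‖χ (((n : ℤ) + 1 : ℤ) : ZMod q)‖ ≤ 1 := χ.norm_le_one _
  have h2 : rexp (-(π * (((n : ℤ) + 1 : ℤ) : ℝ) ^ 2 * y / q)) =
      rexp (-(π * ((n : ℝ) + 1) ^ 2 * (y / q))) := by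
    push_cast; ring_nf
  have h3 : |(((n : ℤ) + 1 : ℤ) : ℝ)| = (n : ℝ) + 1 := by
    push_cast; exact abs_of_nonneg (by positivity)
  rw [h2, h3]
  have h0 : 0 ≤ ((n : ℝ) + 1) * rexp (-(π * ((n : ℝ) + 1) ^ 2 * (y / q))) := by positivity
  calc ‖χ (((n : ℤ) + 1 : ℤ) : ZMod q)‖ * ((n : ℝ) + 1) * rexp (-(π * ((n : ℝ) + 1) ^ 2 * (y / q)))
      = ‖χ (((n : ℤ) + 1 : ℤ) : ZMod q)‖ * (((n : ℝ) + 1) * rexp (-(π * ((n : ℝ) + 1) ^ 2 * (y / q)))) := by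
        ring
    _ ≤ 1 * (((n : ℝ) + 1) * rexp (-(π * ((n : ℝ) + 1) ^ 2 * (y / q)))) :=
        mul_le_mul_of_nonneg_right h1 h0
    _ = _ := one_mul _

omit [NeZero q] in
/-- `χ̄ = χ⁻¹` is odd when `χ` is. [folklore] -/
private theorem odd_inv' (hodd : χ.Odd) : χ⁻¹.Odd := by
  show χ⁻¹ (-1) = -1
  rw [MulChar.inv_apply_eq_inv', hodd, inv_neg, inv_one]

/-- **Louboutin 2006, Proposition 5 (9) / Lemma 6, odd case**: for an odd primitive character `χ` mod `q`,
`(q/π) |L(1, χ)| = |Λ(1, χ)| ≤ I₁(q) = ∫₁^∞ T₁(t/q)(1 + t^{−1/2}) dt` — from the integral representation (4)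
`Λ(1, χ) = ∫₁^∞ {θ(t, χ) t + W(χ) θ(t, χ̄) t^{1/2}} dt/t`, `|W(χ)| = 1`, `|θ(t, ·)| ≤ T₁(t/q)`.
[cite: Louboutin2006RelativeClassNumbers, Prop 5 (9) p. 202 / Lemma 6 p. 203] -/
theorem div_pi_mul_norm_LFunction_one_le_oddMajorant (hprim : χ.IsPrimitive) (hodd : χ.Odd) :
    (q : ℝ) / π * ‖χ.LFunction 1‖ ≤ oddMajorant q := by
  have hχ : χ ≠ 1 := ne_one_of_odd' hodd
  have hq1 : q ≠ 1 := by rintro rfl; exact hχ χ.level_one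
  have hq0 : (0 : ℝ) < q := by exact_mod_cast NeZero.pos q
  have hκ : charParity χ = 1 := charParity_of_odd hodd
  have hodd' : χ⁻¹.Odd := odd_inv' hodd
  -- `ξ(1, χ) = ½ ∫₀^∞ y^0 ϑ₁(y, χ) dy`
  have hxi := dirichletXi_eq_mellin hχ 1
  rw [hκ, Nat.cast_one] at hxi
  have hmel : mellin (dirichletTheta 1 χ) ((1 + 1) / 2) =
      ∫ y in Ioi 0, (((y ^ (0 : ℝ) : ℝ)) : ℂ) * dirichletTheta 1 χ y := by
    rw [mellin]
    refine setIntegral_congr_fun measurableSet_Ioi fun y (hy : 0 < y) ↦ ?_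
    rw [smul_eq_mul, show ((1 : ℂ) + 1) / 2 - 1 = ((0 : ℝ) : ℂ) by push_cast; ring,
      Complex.ofReal_cpow hy.le]
  -- the transformation formula, in the shape `ϑ₁(y, χ) = ε y^{-1/2} Θ''(1/y)`, `Θ''(x) = x ϑ₁(x, χ̄)`
  set Θ'' : ℝ → ℂ := fun x ↦ ((x : ℝ) : ℂ) * dirichletTheta 1 χ⁻¹ x with hΘ''
  have htrans : ∀ y : ℝ, 0 < y → dirichletTheta 1 χ y =
      rootNumber χ * ((y ^ (-(1 / 2 : ℝ)) : ℝ) : ℂ) * Θ'' (1 / y) := by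
    intro y hy
    have h := dirichletTheta_transformation hprim hy
    rw [hκ, Nat.cast_one] at h
    rw [h, hΘ'']
    simp only
    have e : ((y ^ (-(1 / 2 + (1 : ℝ))) : ℝ) : ℂ) = ((y ^ (-(1 / 2 : ℝ)) : ℝ) : ℂ) * (((1 / y : ℝ)) : ℂ) := by
      rw [← Complex.ofReal_mul]
      congr 1
      rw [show (-(1 / 2 + (1 : ℝ))) = -(1 / 2 : ℝ) + (-1) by norm_num, Real.rpow_add hy,
        Real.rpow_neg_one, one_div y]
    rw [e]; ring
  have hint0 : IntegrableOn (fun y : ℝ ↦ ((y ^ (0 : ℝ) : ℝ) : ℂ) * dirichletTheta 1 χ y) (Ioi 0) := by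
    have h := mellinConvergent_dirichletTheta_one χ (((0 : ℝ) : ℂ) + 1)
    rw [MellinConvergent] at h
    refine h.congr_fun (fun y (hy : 0 < y) ↦ ?_) measurableSet_Ioi
    show (y : ℂ) ^ (((0 : ℝ) : ℂ) + 1 - 1) • dirichletTheta 1 χ y = _
    rw [smul_eq_mul, add_sub_cancel_right, Complex.ofReal_cpow hy.le]
  have hsplit := integral_rpow_mul_split 0 htrans hint0
  -- majorants on `(1, ∞)`
  have hwcont : ContinuousOn (fun t : ℝ ↦ (Real.sqrt t)⁻¹) (Ioi 0) :=
    (Real.continuous_sqrt.continuousOn).inv₀ fun x (hx : (0 : ℝ) < x) ↦ (Real.sqrt_pos.mpr hx).ne'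
  have hq1' : (1 : ℝ) ≤ q := by exact_mod_cast NeZero.one_le
  have hI1 : IntegrableOn (fun t ↦ thetaMajorOdd (t / q) * (1 : ℝ)) (Ioi 1) :=
    integrableOn_thetaMajorOdd_div_mul hq1' continuousOn_const (B := 1) fun t _ ↦ by simp
  have hI2 : IntegrableOn (fun t ↦ thetaMajorOdd (t / q) * (Real.sqrt t)⁻¹) (Ioi 1) := by
    refine integrableOn_thetaMajorOdd_div_mul hq1' hwcont (B := 1) fun t ht ↦ ?_
    have hst1 : 1 ≤ Real.sqrt t := Real.one_le_sqrt.mpr ht.le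
    rw [abs_of_nonneg (by positivity)]
    exact inv_le_one_of_one_le₀ hst1
  have b1 : ‖∫ y in Ioi (1 : ℝ), ((y ^ (0 : ℝ) : ℝ) : ℂ) * dirichletTheta 1 χ y‖ ≤
      ∫ t in Ioi (1 : ℝ), 2 * (thetaMajorOdd (t / q) * 1) := by
    refine norm_integral_le_of_norm_le (hI1.const_mul 2) ?_
    refine (ae_restrict_iff' measurableSet_Ioi).mpr (ae_of_all _ fun y (hy : 1 < y) ↦ ?_)
    have hy0 : 0 < y := by linarith
    rw [norm_mul, Real.rpow_zero, Complex.ofReal_one, norm_one, one_mul, mul_one]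
    exact norm_dirichletTheta_one_le hodd hy0
  have b2 : ‖rootNumber χ * ∫ x in Ioi (1 : ℝ), ((x ^ (-(0 : ℝ) - 3 / 2) : ℝ) : ℂ) * Θ'' x‖ ≤
      ∫ t in Ioi (1 : ℝ), 2 * (thetaMajorOdd (t / q) * (Real.sqrt t)⁻¹) := by
    rw [norm_mul, SelbergDirichlet.norm_rootNumber hprim, one_mul]
    refine norm_integral_le_of_norm_le (hI2.const_mul 2) ?_
    refine (ae_restrict_iff' measurableSet_Ioi).mpr (ae_of_all _ fun x (hx : 1 < x) ↦ ?_)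
    have hx0 : 0 < x := by linarith
    rw [hΘ'']
    simp only
    rw [← mul_assoc, norm_mul, ← Complex.ofReal_mul, Complex.norm_real, Real.norm_eq_abs]
    have e : x ^ (-(0 : ℝ) - 3 / 2) * x = (Real.sqrt x)⁻¹ := by
      rw [Real.sqrt_eq_rpow, ← Real.rpow_neg hx0.le,
        show x ^ (-(0 : ℝ) - 3 / 2) * x = x ^ (-(0 : ℝ) - 3 / 2) * x ^ (1 : ℝ) by rw [Real.rpow_one],
        ← Real.rpow_add hx0]
      norm_num
    rw [e, abs_of_nonneg (by positivity)]
    have h := norm_dirichletTheta_one_le hodd' hx0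
    have h0 : 0 ≤ (Real.sqrt x)⁻¹ := by positivity
    calc (Real.sqrt x)⁻¹ * ‖dirichletTheta 1 χ⁻¹ x‖ ≤ (Real.sqrt x)⁻¹ * (2 * thetaMajorOdd (x / q)) :=
          mul_le_mul_of_nonneg_left h h0
      _ = 2 * (thetaMajorOdd (x / q) * (Real.sqrt x)⁻¹) := by ring
  -- `‖ξ(1, χ)‖ = (q/π) |L(1, χ)|`
  have hxiL := dirichletXi_eq_LFunction_mul hχ (s := 1) (fun n ↦ by
    rw [hκ, Nat.cast_one]
    intro h
    have := congrArg Complex.re h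
    simp at this
    have : (0 : ℝ) ≤ n := n.cast_nonneg
    linarith)
  rw [hκ, Nat.cast_one] at hxiL
  have hnorm : ‖dirichletXi χ 1‖ = (q : ℝ) / π * ‖χ.LFunction 1‖ := by
    rw [hxiL, show ((1 : ℂ) + 1) / 2 = 1 by norm_num, Complex.Gamma_one, Complex.cpow_one, norm_mul,
      norm_mul, norm_one, mul_one, norm_div, Complex.norm_natCast, Complex.norm_real, Real.norm_eq_abs,
      abs_of_pos Real.pi_pos]
    ring
  -- assemble
  have esum : (∫ t in Ioi (1 : ℝ), 2 * (thetaMajorOdd (t / q) * 1)) +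
      ∫ t in Ioi (1 : ℝ), 2 * (thetaMajorOdd (t / q) * (Real.sqrt t)⁻¹) = 2 * oddMajorant q := by
    rw [← integral_add (hI1.const_mul 2) (hI2.const_mul 2), oddMajorant, ← integral_const_mul]
    refine setIntegral_congr_fun measurableSet_Ioi fun t _ ↦ ?_
    ring
  have e2 : 2 * dirichletXi χ 1 = (∫ y in Ioi (1 : ℝ), ((y ^ (0 : ℝ) : ℝ) : ℂ) * dirichletTheta 1 χ y) +
      rootNumber χ * ∫ x in Ioi (1 : ℝ), ((x ^ (-(0 : ℝ) - 3 / 2) : ℝ) : ℂ) * Θ'' x := by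
    rw [hxi, hmel, hsplit]; ring
  have key : ‖2 * dirichletXi χ 1‖ ≤ 2 * oddMajorant q := by
    rw [e2]
    calc _ ≤ _ := norm_add_le _ _
      _ ≤ _ := add_le_add b1 b2
      _ = _ := esum
  rw [norm_mul, Complex.norm_ofNat, hnorm] at key
  linarith

/-- **Explicit `|L(1, χ)| ≤ ½ log q + 1.3` for odd primitive characters** (all moduli `q`). Louboutin's
Theorem 1 (i) **(2)** prints the sharper `|L(1, χ)| ≤ ½(log f + κ₁)`, `κ₁ = 2 + γ − log π = 1.4325…`
(constant `κ₁/2 = 0.716…`), whose proof is the Mellin–Barnes shift of Lemma 9 (15); this kernel theorem keeps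
the printed architecture (Lemma 3 (4) → Prop 5 (9) → Lemma 6: `(q/π)|L(1, χ)| ≤ I₁(q)`) and bounds `I₁(q)`
elementarily (`oddMajorant_le`), at the price of the constant `1.3`. The even case, with Louboutin's own
constant `(2 + γ − log 4π)/2 = 0.023…`, is `norm_LFunction_one_le` in `DirichletLOneHalfLogBoundEven`.
[cite: Louboutin2006RelativeClassNumbers, Thm 1 (2) p. 200] -/
theorem norm_LFunction_one_le_of_odd (hprim : χ.IsPrimitive) (hodd : χ.Odd) :
    ‖χ.LFunction 1‖ ≤ Real.log q / 2 + 1.3 := by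
  have hq0 : (0 : ℝ) < q := by exact_mod_cast NeZero.pos q
  have hq1' : (1 : ℝ) ≤ q := by exact_mod_cast NeZero.one_le
  have h1 := div_pi_mul_norm_LFunction_one_le_oddMajorant hprim hodd
  have h2 := oddMajorant_le hq1'
  have hqπ : 0 < (q : ℝ) / π := div_pos hq0 Real.pi_pos
  have h3 : (q : ℝ) / π * ‖χ.LFunction 1‖ ≤ (q : ℝ) / π * ((Real.log q + 2.6) / 2) := by
    calc (q : ℝ) / π * ‖χ.LFunction 1‖ ≤ oddMajorant q := h1
      _ ≤ q / (2 * π) * (Real.log q + 2.6) := h2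
      _ = (q : ℝ) / π * ((Real.log q + 2.6) / 2) := by ring
  have := le_of_mul_le_mul_left h3 hqπ
  linarith

/-- The same bound in the form `|L(1, χ)| ≤ ½ (log q + 2.6)`. [cite: Louboutin2006RelativeClassNumbers, Thm 1 (2) p. 200] -/
theorem norm_LFunction_one_le_half_log_add_of_odd (hprim : χ.IsPrimitive) (hodd : χ.Odd) :
    ‖χ.LFunction 1‖ ≤ (Real.log q + 2.6) / 2 := by
  have := norm_LFunction_one_le_of_odd hprim hodd
  linarith

end Dirichlet

/-! ### Odd quadratic characters: `L(β, χ) = 0 ⇒ L(1, χ) ≤ (1 − β)(log q + ½)²/8` -/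

/-- `t ↦ T₁(t/Q) g(t)` is integrable on `(1, ∞)` for `Q ≥ 1`, `g` continuous on `(0, ∞)` with LINEAR growth
`|g(t)| ≤ B t` on `(1, ∞)` (compact part + tail `t e^{−πt/Q} ≤ (2Q/π) e^{−πt/(2Q)}`). [folklore] -/
private theorem integrableOn_thetaMajorOdd_div_mul_linear {Q : ℝ} (hQ : 1 ≤ Q) {g : ℝ → ℝ} {B : ℝ}
    (hg : ContinuousOn g (Ioi 0)) (hB : ∀ t, 1 < t → |g t| ≤ B * t) :
    IntegrableOn (fun t ↦ thetaMajorOdd (t / Q) * g t) (Ioi 1) := by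
  have hQ0 : 0 < Q := by linarith
  have hB0 : 0 ≤ B := by
    have h := hB 2 (by norm_num)
    have := abs_nonneg (g 2)
    nlinarith
  have hcont : ContinuousOn (fun t ↦ thetaMajorOdd (t / Q) * g t) (Ioi 0) := by
    refine ContinuousOn.mul ?_ hg
    exact continuousOn_thetaMajorOdd.comp (continuousOn_id.div_const Q)
      fun t (ht : (0 : ℝ) < t) ↦ div_pos ht hQ0
  rw [← Ioc_union_Ioi_eq_Ioi hQ]
  refine IntegrableOn.union ?_ ?_
  · exact ((hcont.mono fun t ht ↦ (lt_of_lt_of_le one_pos ht.1 : (0 : ℝ) < t)).integrableOn_compact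
      isCompact_Icc).mono_set Ioc_subset_Icc_self
  · have hb : 0 < π / (2 * Q) := by positivity
    have hdom : IntegrableOn (fun t ↦ 10 / 9 * B * (2 * Q / π) * rexp (-(π / (2 * Q)) * t)) (Ioi Q) :=
      (exp_neg_integrableOn_Ioi Q hb).const_mul _
    refine Integrable.mono' hdom
      ((hcont.mono fun t (ht : Q < t) ↦ (hQ0.trans ht : (0 : ℝ) < t)).aestronglyMeasurable
        measurableSet_Ioi) ?_
    refine (ae_restrict_iff' measurableSet_Ioi).mpr (ae_of_all _ fun t (ht : Q < t) ↦ ?_)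
    have ht1 : 1 < t := lt_of_le_of_lt hQ ht
    have ht0 : 0 < t := by linarith
    have htQ : 1 ≤ t / Q := by rw [le_div_iff₀ hQ0]; linarith
    rw [norm_mul, Real.norm_eq_abs, Real.norm_eq_abs, abs_of_nonneg (thetaMajorOdd_nonneg _)]
    have h1 := thetaMajorOdd_le_exp htQ
    have h2 := hB t ht1
    -- `t e^{-π t/Q} ≤ (2Q/π) e^{-π t/(2Q)}`
    have hx : π / (2 * Q) * t ≤ rexp (π / (2 * Q) * t) := by
      have := Real.add_one_le_exp (π / (2 * Q) * t); linarith
    have e1 : rexp (-(π * (t / Q))) = rexp (-(π / (2 * Q)) * t) * (rexp (π / (2 * Q) * t))⁻¹ := by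
      rw [← Real.exp_neg, ← Real.exp_add]; congr 1; field_simp; ring
    have hkey : t * rexp (-(π * (t / Q))) ≤ (2 * Q / π) * rexp (-(π / (2 * Q)) * t) := by
      rw [e1]
      have hE : 0 < rexp (π / (2 * Q) * t) := Real.exp_pos _
      have hE' : 0 < rexp (-(π / (2 * Q)) * t) := Real.exp_pos _
      rw [← mul_assoc, mul_inv_le_iff₀ hE]
      have : t ≤ 2 * Q / π * (π / (2 * Q) * t) := by field_simp; exact le_rfl
      calc t * rexp (-(π / (2 * Q)) * t) ≤ (2 * Q / π * (π / (2 * Q) * t)) * rexp (-(π / (2 * Q)) * t) :=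
            mul_le_mul_of_nonneg_right this hE'.le
        _ ≤ (2 * Q / π * rexp (π / (2 * Q) * t)) * rexp (-(π / (2 * Q)) * t) := by
            gcongr
        _ = 2 * Q / π * rexp (-(π / (2 * Q)) * t) * rexp (π / (2 * Q) * t) := by ring
    calc thetaMajorOdd (t / Q) * |g t| ≤ (10 / 9 * rexp (-(π * (t / Q)))) * (B * t) :=
          mul_le_mul h1 h2 (abs_nonneg _) (by positivity)
      _ = 10 / 9 * B * (t * rexp (-(π * (t / Q)))) := by ring
      _ ≤ 10 / 9 * B * ((2 * Q / π) * rexp (-(π / (2 * Q)) * t)) :=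
          mul_le_mul_of_nonneg_left hkey (by positivity)
      _ = 10 / 9 * B * (2 * Q / π) * rexp (-(π / (2 * Q)) * t) := by ring

/-- Louboutin's `Ĩ₁(f)` ((8) with `A = 1`, on the real line by Lemma 4 — the right-hand side of (11)):
`Ĩ₁(q) = ∫₁^∞ T₁(t/q) (log t)(1 − t^{−1/2}) dt`. [cite: Louboutin2006RelativeClassNumbers, (8) p. 202 / (11) p. 203] -/
def logMajorantOdd (q : ℝ) : ℝ :=
  ∫ t in Ioi (1 : ℝ), thetaMajorOdd (t / q) * (Real.log t * (1 - (Real.sqrt t)⁻¹))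

/-- The log-weight `(log t)(1 − t^{−1/2})` is continuous on `(0, ∞)`. [folklore] -/
private theorem continuousOn_logWeightOdd :
    ContinuousOn (fun t : ℝ ↦ Real.log t * (1 - (Real.sqrt t)⁻¹)) (Ioi 0) := by
  refine (Real.continuousOn_log.mono fun x (hx : (0 : ℝ) < x) ↦ hx.ne').mul ?_
  exact continuousOn_const.sub ((Real.continuous_sqrt.continuousOn).inv₀
    fun x (hx : (0 : ℝ) < x) ↦ (Real.sqrt_pos.mpr hx).ne')

/-- `0 ≤ (log t)(1 − t^{−1/2}) ≤ t` on `(1, ∞)`. [folklore] -/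
private theorem logWeightOdd_bounds {t : ℝ} (ht : 1 < t) :
    0 ≤ Real.log t * (1 - (Real.sqrt t)⁻¹) ∧ Real.log t * (1 - (Real.sqrt t)⁻¹) ≤ t := by
  have ht0 : 0 < t := by linarith
  have hst1 : 1 ≤ Real.sqrt t := Real.one_le_sqrt.mpr ht.le
  have hi : (Real.sqrt t)⁻¹ ≤ 1 := inv_le_one_of_one_le₀ hst1
  have hi0 : 0 ≤ (Real.sqrt t)⁻¹ := by positivity
  have hlog : 0 ≤ Real.log t := Real.log_nonneg ht.le
  have hlog' : Real.log t ≤ t := by linarith [Real.log_le_sub_one_of_pos ht0]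
  refine ⟨mul_nonneg hlog (by linarith), ?_⟩
  calc Real.log t * (1 - (Real.sqrt t)⁻¹) ≤ Real.log t * 1 :=
        mul_le_mul_of_nonneg_left (by linarith) hlog
    _ ≤ t := by rw [mul_one]; exact hlog'

/-- The integrand of `Ĩ₁(q)` is integrable on `(1, ∞)` (`q ≥ 1`). [folklore] -/
private theorem integrableOn_logMajorantOdd_integrand {Q : ℝ} (hQ : 1 ≤ Q) :
    IntegrableOn (fun t ↦ thetaMajorOdd (t / Q) * (Real.log t * (1 - (Real.sqrt t)⁻¹))) (Ioi 1) := by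
  refine integrableOn_thetaMajorOdd_div_mul_linear hQ continuousOn_logWeightOdd (B := 1) fun t ht ↦ ?_
  obtain ⟨h0, h1⟩ := logWeightOdd_bounds ht
  rw [abs_of_nonneg h0, one_mul]; exact h1

/-- The elementary antiderivative of `(q/(2πt) + c)(log t)(1 − t^{−1/2})`. [folklore] -/
private theorem hasDerivAt_oddLogAnti (q c : ℝ) {t : ℝ} (ht : 0 < t) :
    HasDerivAt (fun t ↦ q / (2 * π) * (Real.log t ^ 2 / 2 + 2 * ((Real.sqrt t)⁻¹ * Real.log t) + 4 * (Real.sqrt t)⁻¹)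
        + c * (t * Real.log t - t - 2 * (Real.sqrt t * Real.log t) + 4 * Real.sqrt t))
      ((q / (2 * π * t) + c) * (Real.log t * (1 - (Real.sqrt t)⁻¹))) t := by
  have hst : 0 < Real.sqrt t := Real.sqrt_pos.mpr ht
  have h1 : HasDerivAt Real.log t⁻¹ t := Real.hasDerivAt_log ht.ne'
  have h2 : HasDerivAt Real.sqrt (1 / (2 * Real.sqrt t)) t := Real.hasDerivAt_sqrt ht.ne'
  have h3 : HasDerivAt (fun t ↦ (Real.sqrt t)⁻¹) (-(1 / (2 * Real.sqrt t)) / Real.sqrt t ^ 2) t :=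
    h2.inv hst.ne'
  have hA := ((((h1.pow 2).div_const 2).add (((h3.mul h1).const_mul 2))).add (h3.const_mul 4)).const_mul
    (q / (2 * π))
  have hB := (((((hasDerivAt_id t).mul h1).sub (hasDerivAt_id t)).sub ((h2.mul h1).const_mul 2)).add
    (h2.const_mul 4)).const_mul c
  refine (hA.add hB).congr_deriv ?_
  have hsq : Real.sqrt t ^ 2 = t := Real.sq_sqrt ht.le
  simp only [id, Nat.cast_ofNat]
  rw [hsq]
  field_simp
  rw [hsq]
  ring

/-- `e^{−3/2} ≥ 0.2231` (upper bound `e^{3/2} ≤ 4.4817…`). [folklore] -/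
private theorem le_exp_neg_three_halves : 0.2231 ≤ rexp (-(3 / 2)) := by
  have h1 : rexp (3 / 2) = rexp 1 * rexp (1 / 2) := by rw [← Real.exp_add]; norm_num
  have h2 : rexp (1 / 2) ^ 2 = rexp 1 := by rw [← Real.exp_nat_mul]; norm_num
  have h3 := Real.exp_one_lt_d9
  have h0 : 0 < rexp (1 / 2) := Real.exp_pos _
  have h4 : rexp (1 / 2) < 1.6488 := by nlinarith
  have h5 : rexp (3 / 2) < 4.482 := by rw [h1]; nlinarith [Real.exp_pos (1 : ℝ)]
  have h6 : 0 < rexp (3 / 2) := Real.exp_pos _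
  rw [Real.exp_neg, le_inv_comm₀ (by norm_num) h6]
  have : (4.482 : ℝ) ≤ 0.2231⁻¹ := by norm_num
  linarith

/-- `e^{−π} ≤ 1/22`. [folklore] -/
private theorem exp_neg_pi_le' : rexp (-π) ≤ 1 / 22 := by
  have hπ := Real.pi_gt_d2
  have h1 : rexp (-π) ≤ rexp (-3.14) := Real.exp_le_exp.mpr (by linarith)
  have h2 : rexp 3.14 = rexp 1 ^ 3 * rexp 0.14 := by
    rw [← Real.exp_nat_mul, ← Real.exp_add]; norm_num
  have h3 := Real.exp_one_gt_d9
  have h4 : (2.7182818283 : ℝ) ^ 3 < rexp 1 ^ 3 := pow_lt_pow_left₀ h3 (by norm_num) (by norm_num)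
  have h5 : (1.14 : ℝ) ≤ rexp 0.14 := by have := Real.add_one_le_exp (0.14 : ℝ); linarith
  have h6 : (22 : ℝ) ≤ rexp 3.14 := by
    rw [h2]; nlinarith [Real.exp_pos (0.14 : ℝ), pow_pos (Real.exp_pos (1 : ℝ)) 3]
  have h7 : rexp (-3.14) ≤ 1 / 22 := by
    rw [Real.exp_neg, inv_eq_one_div]
    exact one_div_le_one_div_of_le (by norm_num) h6
  exact h1.trans h7

/-- `e^{−1−π} ≤ 1/59`. [folklore] -/
private theorem exp_neg_one_sub_pi_le : rexp (-1 - π) ≤ 1 / 59 := by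
  have h1 : rexp (-1 - π) = rexp (-1) * rexp (-π) := by rw [← Real.exp_add]; ring_nf
  have h2 := exp_neg_pi_le'
  have h3 : rexp (-1) ≤ 1 / 2.718 := by
    rw [Real.exp_neg, inv_eq_one_div]
    exact one_div_le_one_div_of_le (by norm_num) (by linarith [Real.exp_one_gt_d9])
  rw [h1]
  calc rexp (-1) * rexp (-π) ≤ 1 / 2.718 * (1 / 22) :=
        mul_le_mul h3 h2 (Real.exp_pos _).le (by norm_num)
    _ ≤ 1 / 59 := by norm_num

/-- **`Ĩ₁(q) ≤ (q/4π)(log q + ½)²`** for every real `q ≥ 3` — an elementary (weaker) substitute for Louboutin's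
**(17)** `Ĩ₁(f) = (f/4π)((log f − κ₁′)² + κ₁″) + ¼√f(log f + κ₁′) + ¼ + θK̃₁/√(π⁵f) ≤ (f/4π) log² f` (`f ≥ 3`,
contour shift): from `T₁(u) ≤ 1/(2πu) + e^{−3/2}/4`, the antiderivative of `(q/(2πt) + c)(log t)(1 − t^{−1/2})`,
`log q ≤ 2(√q − 1)`, and the tail `log t ≤ log q + (t/q − 1)`, `(t/q − 1)e^{−πt/q} ≤ (2/π)e^{−1−π/2}e^{−πt/(2q)}`.
The printed right-hand side `(q/4π) log² q` is `logMajorantOdd_le_sharp` (sequel `DirichletLOneHalfLogBoundOddSharp`).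
[cite: Louboutin2006RelativeClassNumbers, Lemma 9 (17) p. 206] -/
theorem logMajorantOdd_le {q : ℝ} (hq : 3 ≤ q) :
    logMajorantOdd q ≤ q / (4 * π) * (Real.log q + 1 / 2) ^ 2 := by
  have hq1 : 1 ≤ q := by linarith
  have hq0 : 0 < q := by linarith
  have hπ0 := Real.pi_pos
  unfold logMajorantOdd
  set c₀ : ℝ := rexp (-(3 / 2)) / 4 with hc₀
  set w : ℝ → ℝ := fun t ↦ Real.log t * (1 - (Real.sqrt t)⁻¹) with hw
  set F : ℝ → ℝ := fun t ↦ thetaMajorOdd (t / q) * w t with hF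
  have hFint : IntegrableOn F (Ioi 1) := integrableOn_logMajorantOdd_integrand hq1
  -- split `(1, ∞) = (1, q] ∪ (q, ∞)`
  have hsplit : Ioi (1 : ℝ) = Ioc 1 q ∪ Ioi q := (Ioc_union_Ioi_eq_Ioi hq1).symm
  have hdisj : Disjoint (Ioc (1 : ℝ) q) (Ioi q) :=
    Set.disjoint_left.mpr fun x hx hx' ↦ (not_lt.mpr hx.2) hx'
  have e0 : ∫ t in Ioi 1, F t = (∫ t in Ioc 1 q, F t) + ∫ t in Ioi q, F t := by
    rw [hsplit]
    exact setIntegral_union hdisj measurableSet_Ioi (hFint.mono_set Ioc_subset_Ioi_self)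
      (hFint.mono_set (Ioi_subset_Ioi hq1))
  have hmain : ∀ t, 0 < t → thetaMajorOdd (t / q) ≤ q / (2 * π * t) + c₀ := by
    intro t ht
    have h := thetaMajorOdd_le_main (div_pos ht hq0)
    have e : 1 / (2 * π * (t / q)) = q / (2 * π * t) := by field_simp
    rwa [e] at h
  -- piece over `(1, q]`
  set A : ℝ → ℝ := fun t ↦ q / (2 * π) * (Real.log t ^ 2 / 2 + 2 * ((Real.sqrt t)⁻¹ * Real.log t)
      + 4 * (Real.sqrt t)⁻¹) + c₀ * (t * Real.log t - t - 2 * (Real.sqrt t * Real.log t) + 4 * Real.sqrt t) with hA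
  have p1 : ∫ t in Ioc 1 q, F t ≤ A q - A 1 := by
    rw [← intervalIntegral.integral_of_le hq1]
    have hG : ∀ t ∈ uIcc 1 q, HasDerivAt A ((q / (2 * π * t) + c₀) * w t) t := by
      intro t ht; rw [uIcc_of_le hq1] at ht; exact hasDerivAt_oddLogAnti q c₀ (by linarith [ht.1])
    have hsub : Icc 1 q ⊆ Ioi (0 : ℝ) := fun t ht ↦ (lt_of_lt_of_le one_pos ht.1 : (0 : ℝ) < t)
    have hGcont : ContinuousOn (fun t ↦ (q / (2 * π * t) + c₀) * w t) (uIcc 1 q) := by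
      rw [uIcc_of_le hq1]
      refine ContinuousOn.mul ?_ (continuousOn_logWeightOdd.mono hsub)
      refine ContinuousOn.add ?_ continuousOn_const
      refine continuousOn_const.div (continuousOn_const.mul continuousOn_id) fun t ht ↦ ?_
      have : (0 : ℝ) < t := hsub ht
      positivity
    have hFI : IntervalIntegrable F volume 1 q :=
      (intervalIntegrable_iff_integrableOn_Ioc_of_le hq1).mpr (hFint.mono_set Ioc_subset_Ioi_self)
    have hle : ∫ t in (1 : ℝ)..q, F t ≤ ∫ t in (1 : ℝ)..q, (q / (2 * π * t) + c₀) * w t := by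
      refine intervalIntegral.integral_mono_on (hab := hq1) (hf := hFI) (hg := hGcont.intervalIntegrable)
        fun t ht ↦ ?_
      rcases eq_or_lt_of_le ht.1 with h | h
      · simp [hF, hw, ← h]
      · exact mul_le_mul_of_nonneg_right (hmain t (by linarith [ht.1])) (logWeightOdd_bounds h).1
    rwa [intervalIntegral.integral_eq_sub_of_hasDerivAt hG hGcont.intervalIntegrable] at hle
  have hA1 : A 1 = q / (2 * π) * 4 + 3 * c₀ := by
    simp only [hA, Real.log_one, Real.sqrt_one, inv_one]; ring
  have hAq : A q = q / (2 * π) * (Real.log q ^ 2 / 2 + 2 * ((Real.sqrt q)⁻¹ * Real.log q)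
      + 4 * (Real.sqrt q)⁻¹) + c₀ * (q * Real.log q - q - 2 * (Real.sqrt q * Real.log q) + 4 * Real.sqrt q) := rfl
  -- piece over `(q, ∞)`
  have p2 : ∫ t in Ioi q, F t ≤
      10 / 9 * (Real.log q * (q / π * rexp (-π)) + (2 / π * rexp (-1 - π / 2)) * (2 * q / π * rexp (-(π / 2)))) := by
    have hb1 : 0 < π / q := by positivity
    have hb2 : 0 < π / (2 * q) := by positivity
    set G : ℝ → ℝ := fun t ↦ 10 / 9 * (Real.log q * rexp (-(π / q) * t)
      + (2 / π * rexp (-1 - π / 2)) * rexp (-(π / (2 * q)) * t)) with hG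
    have hGint : IntegrableOn G (Ioi q) :=
      (((exp_neg_integrableOn_Ioi q hb1).const_mul _).add
        ((exp_neg_integrableOn_Ioi q hb2).const_mul _)).const_mul _
    have hle : ∫ t in Ioi q, F t ≤ ∫ t in Ioi q, G t := by
      refine setIntegral_mono_on (hFint.mono_set (Ioi_subset_Ioi hq1)) hGint measurableSet_Ioi
        fun t (ht : q < t) ↦ ?_
      have ht1 : 1 < t := lt_of_le_of_lt hq1 ht
      have ht0 : 0 < t := by linarith
      have htq : 1 ≤ t / q := by rw [le_div_iff₀ hq0]; linarith
      have h1 := thetaMajorOdd_le_exp htq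
      obtain ⟨hw0, -⟩ := logWeightOdd_bounds ht1
      -- `w t ≤ log t ≤ log q + (t/q - 1)`
      have hwle : w t ≤ Real.log q + (t / q - 1) := by
        have hst1 : 1 ≤ Real.sqrt t := Real.one_le_sqrt.mpr ht1.le
        have hi0 : 0 ≤ (Real.sqrt t)⁻¹ := by positivity
        have hlog : 0 ≤ Real.log t := Real.log_nonneg ht1.le
        have hl : Real.log t = Real.log q + Real.log (t / q) := by
          rw [Real.log_div ht0.ne' hq0.ne']; ring
        have hl2 : Real.log (t / q) ≤ t / q - 1 := Real.log_le_sub_one_of_pos (by positivity)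
        calc w t = Real.log t * (1 - (Real.sqrt t)⁻¹) := rfl
          _ ≤ Real.log t * 1 := mul_le_mul_of_nonneg_left (by linarith) hlog
          _ ≤ Real.log q + (t / q - 1) := by rw [mul_one, hl]; linarith
      -- `(t/q - 1) e^{-π t/q} ≤ (2/π) e^{-1-π/2} e^{-π t/(2q)}`
      have hx0 : 0 ≤ t / q - 1 := by linarith
      have hkey : (t / q - 1) * rexp (-(π * (t / q))) ≤ 2 / π * rexp (-1 - π / 2) * rexp (-(π / (2 * q)) * t) := by
        set x : ℝ := π / 2 * (t / q - 1) with hx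
        have hxe : x ≤ rexp (x - 1) := by have := Real.add_one_le_exp (x - 1); linarith
        have e1 : rexp (-(π * (t / q))) = rexp (-1 - π / 2) * rexp (-(π / (2 * q)) * t) * (rexp (x - 1))⁻¹ := by
          rw [← Real.exp_neg, ← Real.exp_add, ← Real.exp_add]; congr 1; rw [hx]; field_simp; ring
        have e2 : t / q - 1 = 2 / π * x := by rw [hx]; field_simp
        rw [e1, e2]
        have hE : 0 < rexp (x - 1) := Real.exp_pos _
        have hP : 0 < 2 / π * (rexp (-1 - π / 2) * rexp (-(π / (2 * q)) * t)) := by positivity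
        calc 2 / π * x * (rexp (-1 - π / 2) * rexp (-(π / (2 * q)) * t) * (rexp (x - 1))⁻¹)
            = 2 / π * (rexp (-1 - π / 2) * rexp (-(π / (2 * q)) * t)) * (x * (rexp (x - 1))⁻¹) := by ring
          _ ≤ 2 / π * (rexp (-1 - π / 2) * rexp (-(π / (2 * q)) * t)) * 1 := by
              refine mul_le_mul_of_nonneg_left ?_ hP.le
              rw [mul_inv_le_iff₀ hE, one_mul]; exact hxe
          _ = 2 / π * rexp (-1 - π / 2) * rexp (-(π / (2 * q)) * t) := by ring
      have e3 : rexp (-(π * (t / q))) = rexp (-(π / q) * t) := by congr 1; ring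
      have hT0 : 0 ≤ 10 / 9 * rexp (-(π * (t / q))) := by positivity
      calc F t = thetaMajorOdd (t / q) * w t := rfl
        _ ≤ (10 / 9 * rexp (-(π * (t / q)))) * (Real.log q + (t / q - 1)) :=
            mul_le_mul h1 hwle hw0 hT0
        _ = 10 / 9 * (Real.log q * rexp (-(π * (t / q))) + (t / q - 1) * rexp (-(π * (t / q)))) := by ring
        _ ≤ 10 / 9 * (Real.log q * rexp (-(π * (t / q))) + 2 / π * rexp (-1 - π / 2) * rexp (-(π / (2 * q)) * t)) := by
            gcongr
        _ = G t := by simp only [hG, e3]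
    have hval : ∫ t in Ioi q, G t =
        10 / 9 * (Real.log q * (q / π * rexp (-π)) + (2 / π * rexp (-1 - π / 2)) * (2 * q / π * rexp (-(π / 2)))) := by
      have hn1 : -(π / q) < 0 := neg_lt_zero.mpr hb1
      have hn2 : -(π / (2 * q)) < 0 := neg_lt_zero.mpr hb2
      simp only [hG]
      rw [integral_const_mul, integral_add ((exp_neg_integrableOn_Ioi q hb1).const_mul _)
        ((exp_neg_integrableOn_Ioi q hb2).const_mul _), integral_const_mul, integral_const_mul,
        integral_exp_mul_Ioi hn1 q, integral_exp_mul_Ioi hn2 q]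
      have e1 : -(π / q) * q = -π := by field_simp
      have e2 : -(π / (2 * q)) * q = -(π / 2) := by field_simp
      rw [e1, e2]
      field_simp
    linarith
  -- numerics
  have hc0 : c₀ ≤ 0.055875 := by have := exp_neg_three_halves_le; rw [hc₀]; linarith
  have hc0' : 0.055775 ≤ c₀ := by have := le_exp_neg_three_halves; rw [hc₀]; linarith
  have hE1 : rexp (-π) ≤ 1 / 22 := exp_neg_pi_le'
  have hE2 : rexp (-1 - π / 2) * rexp (-(π / 2)) ≤ 1 / 59 := by
    rw [← Real.exp_add, show -1 - π / 2 + -(π / 2) = -1 - π by ring]; exact exp_neg_one_sub_pi_le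
  have hE1' : 0 ≤ rexp (-π) := (Real.exp_pos _).le
  have hE2' : 0 ≤ rexp (-1 - π / 2) * rexp (-(π / 2)) := by positivity
  set L := Real.log q with hL
  set s := Real.sqrt q with hs
  have hs0 : 0 < s := Real.sqrt_pos.mpr hq0
  have hsq : s * s = q := Real.mul_self_sqrt hq0.le
  have hs17 : 1.7 ≤ s := by
    rw [hs, show (1.7 : ℝ) = Real.sqrt (1.7 ^ 2) by rw [Real.sqrt_sq (by norm_num)]]
    exact Real.sqrt_le_sqrt (by linarith)
  have hL1 : 1 ≤ L := by
    rw [hL, ← Real.log_exp 1]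
    refine Real.log_le_log (Real.exp_pos _) ?_
    linarith [Real.exp_one_lt_d9]
  have hLs : L ≤ 2 * (s - 1) := by
    have h := Real.log_le_sub_one_of_pos hs0
    have : Real.log q = 2 * Real.log s := by
      rw [hs, Real.log_sqrt hq0.le]; ring
    rw [hL, this]; linarith
  have hπlo := Real.pi_gt_d4
  have hπhi := Real.pi_lt_d4
  have hqs : q * s⁻¹ = s := by field_simp; rw [sq]; exact hsq.symm
  -- rewrite the bound of `p1` in the monomials `q L², s L, s, q, q L`
  have hP1 : A q - A 1 = q * L ^ 2 / (4 * π) + (s * L + 2 * s) / π - 2 * q / π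
      + c₀ * (q * L - q - 2 * s * L + 4 * s - 3) := by
    rw [hAq, hA1]
    have : q / (2 * π) * (L ^ 2 / 2 + 2 * (s⁻¹ * L) + 4 * s⁻¹) =
        q * L ^ 2 / (4 * π) + (q * s⁻¹ * L + 2 * (q * s⁻¹)) / π := by field_simp; ring
    rw [this, hqs]; ring
  -- the tail in the same currency
  have hP2 : 10 / 9 * (L * (q / π * rexp (-π)) + (2 / π * rexp (-1 - π / 2)) * (2 * q / π * rexp (-(π / 2))))
      ≤ 10 / 9 * (L * (q / π) * (1 / 22) + 4 * q / π ^ 2 * (1 / 59)) := by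
    have t1 : L * (q / π * rexp (-π)) ≤ L * (q / π) * (1 / 22) := by
      have h0 : 0 ≤ L * (q / π) := by positivity
      rw [← mul_assoc]
      exact mul_le_mul_of_nonneg_left hE1 h0
    have t2 : (2 / π * rexp (-1 - π / 2)) * (2 * q / π * rexp (-(π / 2))) ≤ 4 * q / π ^ 2 * (1 / 59) := by
      have e : (2 / π * rexp (-1 - π / 2)) * (2 * q / π * rexp (-(π / 2))) =
          4 * q / π ^ 2 * (rexp (-1 - π / 2) * rexp (-(π / 2))) := by ring
      rw [e]
      exact mul_le_mul_of_nonneg_left hE2 (by positivity)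
    exact mul_le_mul_of_nonneg_left (add_le_add t1 t2) (by norm_num)
  -- target expansion
  have hT : q / (4 * π) * (L + 1 / 2) ^ 2 = q * L ^ 2 / (4 * π) + q * L / (4 * π) + q / (16 * π) := by ring
  rw [e0, hT]
  set ip : ℝ := 1 / π with hip
  have ip_lo : 0.3183 ≤ ip := by rw [hip, le_div_iff₀ hπ0]; linarith
  have ip_hi : ip ≤ 0.3184 := by rw [hip, div_le_iff₀ hπ0]; linarith
  have ip0 : 0 ≤ ip := by positivity
  have hq17 : 1.7 * s ≤ q := by
    have := mul_le_mul_of_nonneg_right hs17 hs0.le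
    rwa [hsq] at this
  have u1 : s * L ≤ 2 * q - 2 * s := by
    have h := mul_le_mul_of_nonneg_left hLs hs0.le
    have e : s * (2 * (s - 1)) = 2 * q - 2 * s := by rw [← hsq]; ring
    linarith
  have hqL : 0 ≤ q * L := by positivity
  have hsL : 0 ≤ s * L := by positivity
  -- term-by-term numeric bounds
  have b1 : (s * L + 2 * s) * ip ≤ (s * L + 2 * s) * 0.3184 :=
    mul_le_mul_of_nonneg_left ip_hi (by positivity)
  have b2 : 2 * q * 0.3183 ≤ 2 * q * ip := mul_le_mul_of_nonneg_left ip_lo (by positivity)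
  have b3 : c₀ * (q * L) ≤ 0.055875 * (q * L) := mul_le_mul_of_nonneg_right hc0 hqL
  have b4 : 0.055775 * q ≤ c₀ * q := mul_le_mul_of_nonneg_right hc0' hq0.le
  have b5 : 0.055775 * (s * L) ≤ c₀ * (s * L) := mul_le_mul_of_nonneg_right hc0' hsL
  have b6 : c₀ * s ≤ 0.055875 * s := mul_le_mul_of_nonneg_right hc0 hs0.le
  have b8 : q * L * ip ≤ q * L * 0.3184 := mul_le_mul_of_nonneg_left ip_hi hqL
  have b8' : q * L * 0.3183 ≤ q * L * ip := mul_le_mul_of_nonneg_left ip_lo hqL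
  have b9 : ip * ip ≤ 0.3184 * 0.3184 := mul_le_mul ip_hi ip_hi ip0 (by norm_num)
  have b9' : 4 * q * (ip * ip) ≤ 4 * q * (0.3184 * 0.3184) := mul_le_mul_of_nonneg_left b9 (by positivity)
  have b11 : q * 0.3183 ≤ q * ip := mul_le_mul_of_nonneg_left ip_lo hq0.le
  have key : (s * L + 2 * s) / π - 2 * q / π + c₀ * (q * L - q - 2 * s * L + 4 * s - 3)
      + 10 / 9 * (L * (q / π) * (1 / 22) + 4 * q / π ^ 2 * (1 / 59)) ≤ q * L / (4 * π) + q / (16 * π) := by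
    have i1 : (s * L + 2 * s) / π = (s * L + 2 * s) * ip := by rw [hip]; ring
    have i2 : 2 * q / π = 2 * q * ip := by rw [hip]; ring
    have i3 : L * (q / π) * (1 / 22) = q * L * ip / 22 := by rw [hip]; ring
    have i4 : 4 * q / π ^ 2 * (1 / 59) = 4 * q * (ip * ip) / 59 := by rw [hip]; field_simp
    have i5 : q * L / (4 * π) = q * L * ip / 4 := by rw [hip]; ring
    have i6 : q / (16 * π) = q * ip / 16 := by rw [hip]; ring
    rw [i1, i2, i3, i4, i5, i6]
    linarith
  linarith [p1, p2, hP1, hP2, key]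

section DirichletZero

open DirichletCharacter DirichletTheta

variable {q : ℕ} [NeZero q] {χ : DirichletCharacter ℂ q}

/-- The kernel `ψ_t(s) = t^{(s−1)/2} + t^{−s/2}` of `2Λ(s, χ) = ∫₁^∞ ψ_t(s) ϑ₁(t, χ) dt` (odd quadratic `χ`,
`W(χ) = 1`, `A = 1`: `t^{(s+A)/2 − 1} + t^{(1−s+A)/2 − 1}`). [cite: Louboutin2006RelativeClassNumbers, (4) p. 201] -/
def xiKernelOdd (t s : ℝ) : ℝ := t ^ ((s - 1) / 2) + t ^ (-s / 2)

/-- **Louboutin's (11) at `A = 1`**: for `t ≥ 1` and `½ ≤ β ≤ 1`,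
`0 ≤ ψ_t(1) − ψ_t(β) ≤ (1 − β) · ½ (log t)(1 − t^{−1/2})`. [cite: Louboutin2006RelativeClassNumbers, (11) p. 203] -/
theorem xiKernelOdd_one_sub_le {t β : ℝ} (ht : 1 ≤ t) (hβ : 1 / 2 ≤ β) (hβ1 : β ≤ 1) :
    0 ≤ xiKernelOdd t 1 - xiKernelOdd t β ∧
      xiKernelOdd t 1 - xiKernelOdd t β ≤ (1 - β) * (Real.log t * (1 - (Real.sqrt t)⁻¹) / 2) := by
  have ht0 : 0 < t := by linarith
  set ℓ := Real.log t with hℓ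
  have hℓ0 : 0 ≤ ℓ := Real.log_nonneg ht
  set φ : ℝ → ℝ := fun s ↦ Real.exp (((s - 1) / 2) * ℓ) + Real.exp ((-s / 2) * ℓ) with hφ
  have hφeq : ∀ s, xiKernelOdd t s = φ s := by
    intro s
    simp only [xiKernelOdd, hφ, Real.rpow_def_of_pos ht0, hℓ]
    ring_nf
  have hderiv : ∀ s, HasDerivAt φ (Real.exp (((s - 1) / 2) * ℓ) * (ℓ / 2) -
      Real.exp ((-s / 2) * ℓ) * (ℓ / 2)) s := by
    intro s
    have h1 : HasDerivAt (fun s : ℝ ↦ ((s - 1) / 2) * ℓ) (1 / 2 * ℓ) s := by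
      have := ((hasDerivAt_id s).sub_const 1).div_const 2 |>.mul_const ℓ
      simpa using this
    have h2 : HasDerivAt (fun s : ℝ ↦ (-s / 2) * ℓ) (-1 / 2 * ℓ) s := by
      have := ((hasDerivAt_id s).neg).div_const 2 |>.mul_const ℓ
      simpa [neg_div] using this
    have := (h1.exp).add (h2.exp)
    refine this.congr_deriv ?_
    ring
  set c : ℝ := Real.log t * (1 - (Real.sqrt t)⁻¹) / 2 with hc
  have hsqrt : (Real.sqrt t)⁻¹ = Real.exp (-(1 / 2) * ℓ) := by
    rw [Real.sqrt_eq_rpow, Real.rpow_def_of_pos ht0, ← Real.exp_neg, hℓ]; ring_nf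
  have hderiv_bds : ∀ s ∈ interior (Icc (1 / 2 : ℝ) 1), 0 ≤ deriv φ s ∧ deriv φ s ≤ c := by
    intro s hs
    rw [interior_Icc] at hs
    rw [(hderiv s).deriv]
    have e1 : Real.exp ((-s / 2) * ℓ) ≤ Real.exp (((s - 1) / 2) * ℓ) :=
      Real.exp_le_exp.mpr (by nlinarith [hs.1])
    have e2 : Real.exp (((s - 1) / 2) * ℓ) ≤ Real.exp (0 * ℓ) :=
      Real.exp_le_exp.mpr (by nlinarith [hs.2])
    have e3 : Real.exp (-(1 / 2) * ℓ) ≤ Real.exp ((-s / 2) * ℓ) :=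
      Real.exp_le_exp.mpr (by nlinarith [hs.2])
    rw [zero_mul, Real.exp_zero] at e2
    constructor
    · nlinarith
    · rw [hc, hsqrt, ← hℓ]; nlinarith
  have hcont : ContinuousOn φ (Icc (1 / 2 : ℝ) 1) := fun s _ ↦ (hderiv s).continuousAt.continuousWithinAt
  have hdiff : DifferentiableOn ℝ φ (interior (Icc (1 / 2 : ℝ) 1)) :=
    fun s _ ↦ (hderiv s).differentiableAt.differentiableWithinAt
  have hβD : β ∈ Icc (1 / 2 : ℝ) 1 := ⟨hβ, hβ1⟩
  have h1D : (1 : ℝ) ∈ Icc (1 / 2 : ℝ) 1 := ⟨by norm_num, le_rfl⟩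
  have lo := (convex_Icc (1 / 2 : ℝ) 1).mul_sub_le_image_sub_of_le_deriv hcont hdiff
    (fun s hs ↦ (hderiv_bds s hs).1) β hβD 1 h1D hβ1
  have hi := (convex_Icc (1 / 2 : ℝ) 1).image_sub_le_mul_sub_of_deriv_le hcont hdiff
    (fun s hs ↦ (hderiv_bds s hs).2) β hβD 1 h1D hβ1
  rw [hφeq, hφeq]
  constructor
  · linarith
  · calc φ 1 - φ β ≤ c * (1 - β) := hi
      _ = (1 - β) * c := mul_comm _ _

/-- `∫₀^∞ y^a ϑ₁(y, χ) dy` converges absolutely for every real `a`. [folklore] -/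
private theorem integrableOn_rpow_mul_dirichletTheta_one (χ : DirichletCharacter ℂ q) (a : ℝ) :
    IntegrableOn (fun y : ℝ ↦ ((y ^ a : ℝ) : ℂ) * dirichletTheta 1 χ y) (Ioi 0) := by
  have h := mellinConvergent_dirichletTheta_one χ ((a : ℂ) + 1)
  rw [MellinConvergent] at h
  refine h.congr_fun (fun y (hy : 0 < y) ↦ ?_) measurableSet_Ioi
  show (y : ℂ) ^ ((a : ℂ) + 1 - 1) • dirichletTheta 1 χ y = _
  rw [smul_eq_mul, add_sub_cancel_right, Complex.ofReal_cpow hy.le]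

/-- **Louboutin's (4) for an odd quadratic primitive character** (`W(χ) = 1`, `χ̄ = χ`, `A = 1`): for real `σ`,
`2 Λ(σ, χ) = ∫₁^∞ (t^{(σ−1)/2} + t^{−σ/2}) ϑ₁(t, χ) dt`. [cite: Louboutin2006RelativeClassNumbers, Lemma 3 (4) p. 201] -/
theorem two_mul_dirichletXi_eq_integral_xiKernelOdd (hprim : χ.IsPrimitive) (hodd : χ.Odd)
    (hquad : χ.IsQuadratic) (σ : ℝ) :
    2 * dirichletXi χ σ = ∫ t in Ioi (1 : ℝ), ((xiKernelOdd t σ : ℝ) : ℂ) * dirichletTheta 1 χ t := by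
  have hχ : χ ≠ 1 := ne_one_of_odd' hodd
  have hκ : charParity χ = 1 := charParity_of_odd hodd
  have hε : rootNumber χ = 1 := PrimitiveQuadratic.rootNumber_eq_one_of_isQuadratic hprim hquad
  have hinv : χ⁻¹ = χ := hquad.inv
  have hxi := dirichletXi_eq_mellin hχ σ
  rw [hκ, Nat.cast_one] at hxi
  have hmel : mellin (dirichletTheta 1 χ) (((σ : ℂ) + 1) / 2) =
      ∫ y in Ioi 0, (((y ^ ((σ - 1) / 2) : ℝ)) : ℂ) * dirichletTheta 1 χ y := by
    rw [mellin]
    refine setIntegral_congr_fun measurableSet_Ioi fun y (hy : 0 < y) ↦ ?_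
    rw [smul_eq_mul, show ((σ : ℂ) + 1) / 2 - 1 = (((σ - 1) / 2 : ℝ) : ℂ) by push_cast; ring,
      Complex.ofReal_cpow hy.le]
  set Θ'' : ℝ → ℂ := fun x ↦ ((x : ℝ) : ℂ) * dirichletTheta 1 χ x with hΘ''
  have htrans : ∀ y : ℝ, 0 < y → dirichletTheta 1 χ y =
      1 * ((y ^ (-(1 / 2 : ℝ)) : ℝ) : ℂ) * Θ'' (1 / y) := by
    intro y hy
    have h := dirichletTheta_transformation hprim hy
    rw [hκ, Nat.cast_one, hε, hinv] at h
    rw [h, hΘ'']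
    simp only
    have e : ((y ^ (-(1 / 2 + (1 : ℝ))) : ℝ) : ℂ) = ((y ^ (-(1 / 2 : ℝ)) : ℝ) : ℂ) * (((1 / y : ℝ)) : ℂ) := by
      rw [← Complex.ofReal_mul]
      congr 1
      rw [show (-(1 / 2 + (1 : ℝ))) = -(1 / 2 : ℝ) + (-1) by norm_num, Real.rpow_add hy,
        Real.rpow_neg_one, one_div y]
    rw [e]; ring
  have hsplit := integral_rpow_mul_split ((σ - 1) / 2) htrans (integrableOn_rpow_mul_dirichletTheta_one χ _)
  rw [one_mul] at hsplit
  have hI1 : IntegrableOn (fun y : ℝ ↦ ((y ^ ((σ - 1) / 2) : ℝ) : ℂ) * dirichletTheta 1 χ y) (Ioi 1) :=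
    (integrableOn_rpow_mul_dirichletTheta_one χ _).mono_set (Ioi_subset_Ioi zero_le_one)
  have hI2 : IntegrableOn (fun y : ℝ ↦ ((y ^ (-σ / 2) : ℝ) : ℂ) * dirichletTheta 1 χ y) (Ioi 1) :=
    (integrableOn_rpow_mul_dirichletTheta_one χ _).mono_set (Ioi_subset_Ioi zero_le_one)
  have hI2' : (∫ x in Ioi (1 : ℝ), ((x ^ (-((σ - 1) / 2) - 3 / 2) : ℝ) : ℂ) * Θ'' x) =
      ∫ x in Ioi (1 : ℝ), ((x ^ (-σ / 2) : ℝ) : ℂ) * dirichletTheta 1 χ x := by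
    refine setIntegral_congr_fun measurableSet_Ioi fun x (hx : 1 < x) ↦ ?_
    have hx0 : 0 < x := by linarith
    simp only [hΘ'']
    rw [← mul_assoc, ← Complex.ofReal_mul]
    congr 2
    rw [show x ^ (-((σ - 1) / 2) - 3 / 2) * x = x ^ (-((σ - 1) / 2) - 3 / 2) * x ^ (1 : ℝ) by rw [Real.rpow_one],
      ← Real.rpow_add hx0]
    ring_nf
  rw [hxi, hmel, hsplit, hI2', ← integral_add hI1 hI2]
  rw [show (2 : ℂ) * (1 / 2 * _) = _ from by ring]
  refine setIntegral_congr_fun measurableSet_Ioi fun t _ ↦ ?_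
  simp only [xiKernelOdd]; push_cast; ring

/-- `‖Λ(1, χ)‖ = (q/π) |L(1, χ)|` for odd `χ` (`Γ(1)(q/π)^1`). [cite: Louboutin2006RelativeClassNumbers, Lemma 6 p. 203] -/
theorem norm_dirichletXi_one_of_odd (hodd : χ.Odd) :
    ‖dirichletXi χ 1‖ = (q : ℝ) / π * ‖χ.LFunction 1‖ := by
  have hχ : χ ≠ 1 := ne_one_of_odd' hodd
  have hκ : charParity χ = 1 := charParity_of_odd hodd
  have hxiL := dirichletXi_eq_LFunction_mul hχ (s := 1) (fun n ↦ by
    rw [hκ, Nat.cast_one]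
    intro h
    have := congrArg Complex.re h
    simp at this
    have : (0 : ℝ) ≤ n := n.cast_nonneg
    linarith)
  rw [hκ, Nat.cast_one] at hxiL
  rw [hxiL, show ((1 : ℂ) + 1) / 2 = 1 by norm_num, Complex.Gamma_one, Complex.cpow_one, norm_mul,
    norm_mul, norm_one, mul_one, norm_div, Complex.norm_natCast, Complex.norm_real, Real.norm_eq_abs,
    abs_of_pos Real.pi_pos]
  ring

/-- **Odd quadratic case of Theorem 1 (ii), `½ ≤ β ≤ 1`, with the elementary constant**: for an odd quadratic
primitive `χ` mod `q`, `L(β, χ) = 0` with `½ ≤ β ≤ 1` implies `|L(1, χ)| ≤ (1 − β)(log q + ½)²/8`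
(Prop. 5 (10)/Lemma 6: `(q/π)|L(1, χ)| ≤ (1 − β)/2 · Ĩ₁(q)`, then `logMajorantOdd_le` for the printed
`Ĩ₁(f) ≤ (f/4π) log² f`). [cite: Louboutin2006RelativeClassNumbers, Prop 5 (10) p. 202 / Lemma 6 p. 204] -/
theorem norm_LFunction_one_le_of_zero_of_odd_of_half_le (hprim : χ.IsPrimitive) (hodd : χ.Odd)
    (hquad : χ.IsQuadratic) {β : ℝ} (hβ : 1 / 2 ≤ β) (hβ1 : β ≤ 1) (hzero : χ.LFunction β = 0) :
    ‖χ.LFunction 1‖ ≤ (1 - β) * (Real.log q + 1 / 2) ^ 2 / 8 := by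
  have hχ : χ ≠ 1 := ne_one_of_odd' hodd
  have hκ : charParity χ = 1 := charParity_of_odd hodd
  have hq0 : (0 : ℝ) < q := by exact_mod_cast NeZero.pos q
  -- `q ≥ 3`: an odd character needs `-1 ≠ 1` in `ZMod q`
  have hq3 : (3 : ℝ) ≤ q := by
    have h2 : q ≠ 1 := by rintro rfl; exact hχ χ.level_one
    have h2' : q ≠ 2 := by
      rintro rfl
      have h : χ (-1) = -1 := hodd
      have : (-1 : ZMod 2) = 1 := by decide
      rw [this, map_one] at h
      norm_num at h
    have : 3 ≤ q := by have := NeZero.ne q; omega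
    exact_mod_cast this
  -- `Λ(β) = 0`
  have hxiβ : dirichletXi χ β = 0 := by
    refine (dirichletXi_eq_zero_iff hχ fun n h ↦ ?_).mpr hzero
    rw [hκ, Nat.cast_one] at h
    have := congrArg Complex.re h
    simp at this
    have : (0 : ℝ) ≤ n := n.cast_nonneg
    linarith
  have h1 := two_mul_dirichletXi_eq_integral_xiKernelOdd hprim hodd hquad 1
  have hβ' := two_mul_dirichletXi_eq_integral_xiKernelOdd hprim hodd hquad β
  rw [hxiβ, mul_zero] at hβ'
  have hIk : ∀ σ : ℝ, IntegrableOn (fun t : ℝ ↦ ((xiKernelOdd t σ : ℝ) : ℂ) * dirichletTheta 1 χ t) (Ioi 1) := by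
    intro σ
    have hI1 : IntegrableOn (fun y : ℝ ↦ ((y ^ ((σ - 1) / 2) : ℝ) : ℂ) * dirichletTheta 1 χ y) (Ioi 1) :=
      (integrableOn_rpow_mul_dirichletTheta_one χ _).mono_set (Ioi_subset_Ioi zero_le_one)
    have hI2 : IntegrableOn (fun y : ℝ ↦ ((y ^ (-σ / 2) : ℝ) : ℂ) * dirichletTheta 1 χ y) (Ioi 1) :=
      (integrableOn_rpow_mul_dirichletTheta_one χ _).mono_set (Ioi_subset_Ioi zero_le_one)
    refine (hI1.add hI2).congr_fun (fun t _ ↦ ?_) measurableSet_Ioi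
    simp only [xiKernelOdd, Pi.add_apply]; push_cast; ring
  rw [Complex.ofReal_one] at h1
  have hdiff : 2 * dirichletXi χ 1 =
      ∫ t in Ioi (1 : ℝ), (((xiKernelOdd t 1 - xiKernelOdd t β : ℝ)) : ℂ) * dirichletTheta 1 χ t := by
    have : ∫ t in Ioi (1 : ℝ), (((xiKernelOdd t 1 - xiKernelOdd t β : ℝ)) : ℂ) * dirichletTheta 1 χ t =
        (∫ t in Ioi (1 : ℝ), ((xiKernelOdd t 1 : ℝ) : ℂ) * dirichletTheta 1 χ t) -
        ∫ t in Ioi (1 : ℝ), ((xiKernelOdd t β : ℝ) : ℂ) * dirichletTheta 1 χ t := by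
      rw [← integral_sub (hIk 1) (hIk β)]
      refine setIntegral_congr_fun measurableSet_Ioi fun t _ ↦ ?_
      push_cast; ring
    rw [this, ← h1, ← hβ', sub_zero]
  have hq1 : (1 : ℝ) ≤ q := by linarith
  have hmaj : ‖2 * dirichletXi χ 1‖ ≤ (1 - β) * logMajorantOdd q := by
    rw [hdiff, logMajorantOdd, ← integral_const_mul]
    refine norm_integral_le_of_norm_le ((integrableOn_logMajorantOdd_integrand hq1).const_mul _) ?_
    refine (ae_restrict_iff' measurableSet_Ioi).mpr (ae_of_all _ fun t (ht : 1 < t) ↦ ?_)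
    have ht0 : 0 < t := by linarith
    obtain ⟨hlo, hhi⟩ := xiKernelOdd_one_sub_le ht.le hβ hβ1
    rw [norm_mul, Complex.norm_real, Real.norm_eq_abs, abs_of_nonneg hlo]
    have hθ := norm_dirichletTheta_one_le hodd ht0
    have hT0 : 0 ≤ thetaMajorOdd (t / q) := thetaMajorOdd_nonneg _
    calc (xiKernelOdd t 1 - xiKernelOdd t β) * ‖dirichletTheta 1 χ t‖
        ≤ ((1 - β) * (Real.log t * (1 - (Real.sqrt t)⁻¹) / 2)) * (2 * thetaMajorOdd (t / q)) :=
          mul_le_mul hhi hθ (norm_nonneg _) (by nlinarith)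
      _ = (1 - β) * (thetaMajorOdd (t / q) * (Real.log t * (1 - (Real.sqrt t)⁻¹))) := by ring
  have hM := logMajorantOdd_le hq3
  rw [norm_mul, Complex.norm_ofNat, norm_dirichletXi_one_of_odd hodd] at hmaj
  have h1β : 0 ≤ 1 - β := by linarith
  have hqπ : 0 < (q : ℝ) / π := div_pos hq0 Real.pi_pos
  have : 2 * ((q : ℝ) / π * ‖χ.LFunction 1‖) ≤ (1 - β) * ((q : ℝ) / (4 * π) * (Real.log q + 1 / 2) ^ 2) :=
    hmaj.trans (mul_le_mul_of_nonneg_left hM h1β)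
  have e : (1 - β) * ((q : ℝ) / (4 * π) * (Real.log q + 1 / 2) ^ 2) =
      (q : ℝ) / π * (2 * ((1 - β) * (Real.log q + 1 / 2) ^ 2 / 8)) := by ring
  rw [e, ← mul_assoc, mul_comm 2 ((q : ℝ) / π), mul_assoc] at this
  have := le_of_mul_le_mul_left this hqπ
  linarith

/-- **Louboutin 2006, Theorem 1 (ii), ODD quadratic case, with the elementary constant**: for an odd quadratic
primitive `χ` mod `q`, `0 < β < 1` and `L(β, χ) = 0` imply **`|L(1, χ)| ≤ (1 − β)(log q + ½)²/8`** (printed: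
`(1 − β) log² f/8`, from (17) by the contour shift; here `Ĩ₁(q) ≤ (q/4π)(log q + ½)²` elementarily; the printed
form is `norm_LFunction_one_le_of_zero_of_odd_sharp` in the sequel `DirichletLOneHalfLogBoundOddSharp`). The
reduction to `β ≥ ½` is the functional equation (5) with `W(χ) = 1`. [cite: Louboutin2006RelativeClassNumbers, Thm 1 (3) p. 200] -/
theorem norm_LFunction_one_le_of_zero_of_odd (hprim : χ.IsPrimitive) (hodd : χ.Odd)
    (hquad : χ.IsQuadratic) {β : ℝ} (hβ0 : 0 < β) (hβ1 : β < 1) (hzero : χ.LFunction β = 0) :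
    ‖χ.LFunction 1‖ ≤ (1 - β) * (Real.log q + 1 / 2) ^ 2 / 8 := by
  rcases le_or_gt (1 / 2 : ℝ) β with hβ | hβ
  · exact norm_LFunction_one_le_of_zero_of_odd_of_half_le hprim hodd hquad hβ hβ1.le hzero
  · have hχ : χ ≠ 1 := ne_one_of_odd' hodd
    have hκ : charParity χ = 1 := charParity_of_odd hodd
    have hε : rootNumber χ = 1 := PrimitiveQuadratic.rootNumber_eq_one_of_isQuadratic hprim hquad
    have hxiβ : dirichletXi χ β = 0 := by
      refine (dirichletXi_eq_zero_iff hχ fun n h ↦ ?_).mpr hzero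
      rw [hκ, Nat.cast_one] at h
      have := congrArg Complex.re h
      simp at this
      have : (0 : ℝ) ≤ n := n.cast_nonneg
      linarith
    have hfe := dirichletXi_eq_rootNumber_mul_dirichletXi_inv_one_sub hprim (β : ℂ)
    rw [hxiβ, hε, one_mul, hquad.inv] at hfe
    have hzero' : χ.LFunction ((1 - β : ℝ) : ℂ) = 0 := by
      push_cast
      refine (dirichletXi_eq_zero_iff hχ fun n h ↦ ?_).mp hfe.symm
      rw [hκ, Nat.cast_one] at h
      have := congrArg Complex.re h
      simp at this
      have : (0 : ℝ) ≤ n := n.cast_nonneg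
      linarith
    have h := norm_LFunction_one_le_of_zero_of_odd_of_half_le hprim hodd hquad (β := 1 - β)
      (by linarith) (by linarith) hzero'
    have hlog : 0 ≤ (Real.log q + 1 / 2) ^ 2 := sq_nonneg _
    nlinarith

/-- The printed shape **`0 < L(1, χ) ≤ (1 − β)(log q + ½)²/8`** on the real number `L(1, χ)` (quadratic `χ`:
`L(1, χ) > 0`, tree `Siegel.LFunction_one_re_pos`). [cite: Louboutin2006RelativeClassNumbers, Thm 1 (3) p. 200] -/
theorem LFunction_one_re_pos_and_le_of_zero_of_odd (hprim : χ.IsPrimitive) (hodd : χ.Odd)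
    (hquad : χ.IsQuadratic) {β : ℝ} (hβ0 : 0 < β) (hβ1 : β < 1) (hzero : χ.LFunction β = 0) :
    0 < (χ.LFunction 1).re ∧ (χ.LFunction 1).re ≤ (1 - β) * (Real.log q + 1 / 2) ^ 2 / 8 := by
  have hsq : χ ^ 2 = 1 := hquad.sq_eq_one
  refine ⟨Siegel.LFunction_one_re_pos χ (ne_one_of_odd' hodd) hsq, ?_⟩
  exact (Complex.re_le_norm _).trans
    (norm_LFunction_one_le_of_zero_of_odd hprim hodd hquad hβ0 hβ1 hzero)

end DirichletZero

/-! ### Parity-free forms for every primitive character -/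

section ParityFree

open DirichletCharacter

variable {q : ℕ} [NeZero q] {χ : DirichletCharacter ℂ q}

/-- **`|L(1, χ)| ≤ ½ log q + 1.3` for EVERY primitive `χ ≠ 1`** (parity-free reading of Theorem 1 (i) (2)
through the tree's kernel forms: even `χ`: `norm_LFunction_one_le_half_log_add_d4` (`½ log q + 0.0231`,
`DirichletLOneHalfLogBoundEven`), odd `χ`: `norm_LFunction_one_le_of_odd` (`½ log q + 1.3`)). A kernel
substitute, with the weaker constant, for the parity-free reading `Ramare2001.norm_LFunction_one_le` of the
NAMED fact `ramare2001_corollary1` (`½ log q + 5/2 − log 6`). [cite: Louboutin2006RelativeClassNumbers, Thm 1 (2) p. 200] -/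
theorem norm_LFunction_one_le_of_isPrimitive (hprim : χ.IsPrimitive) (hχ : χ ≠ 1) :
    ‖χ.LFunction 1‖ ≤ Real.log q / 2 + 1.3 := by
  rcases χ.even_or_odd with heven | hodd
  · have h := norm_LFunction_one_le_half_log_add_d4 χ hprim hχ heven
    linarith
  · exact norm_LFunction_one_le_of_odd hprim hodd

/-- **`L(β, χ) = 0 ⇒ |L(1, χ)| ≤ (1 − β)(log q + ½)²/8` for EVERY quadratic primitive `χ ≠ 1`** and real
`0 < β < 1` (parity-free reading of Theorem 1 (ii) (3): even `χ`: `norm_LFunction_one_le_of_zero`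
(`(1 − β) log² q/8`, `DirichletLOneRealZeroBoundEvenQuadratic`), odd `χ`: `norm_LFunction_one_le_of_zero_of_odd`).
Compare the tree's `norm_LFunction_one_le_mul_log_sq` (`55 (1 − β) log² q` for `β ≥ 1 − 1/(4 log q)`, any
`χ ≠ 1`, `RealZeroEffectiveRepulsionExplicit`). [cite: Louboutin2006RelativeClassNumbers, Thm 1 (3) p. 200] -/
theorem norm_LFunction_one_le_of_zero_of_isPrimitive (hprim : χ.IsPrimitive) (hχ : χ ≠ 1)
    (hquad : χ.IsQuadratic) {β : ℝ} (hβ0 : 0 < β) (hβ1 : β < 1) (hzero : χ.LFunction β = 0) :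
    ‖χ.LFunction 1‖ ≤ (1 - β) * (Real.log q + 1 / 2) ^ 2 / 8 := by
  rcases χ.even_or_odd with heven | hodd
  · have h := norm_LFunction_one_le_of_zero hprim hχ heven hquad hβ0 hβ1 hzero
    have hq1 : (1 : ℝ) ≤ q := by exact_mod_cast NeZero.one_le
    have hlog : 0 ≤ Real.log q := Real.log_nonneg hq1
    have h1β : 0 ≤ 1 - β := by linarith
    have hsq : Real.log q ^ 2 ≤ (Real.log q + 1 / 2) ^ 2 := by nlinarith
    have := mul_le_mul_of_nonneg_left hsq h1β
    linarith
  · exact norm_LFunction_one_le_of_zero_of_odd hprim hodd hquad hβ0 hβ1 hzero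

/-- The printed two-sided shape for every quadratic primitive `χ ≠ 1`: `L(β, χ) = 0`, `0 < β < 1` ⇒
`0 < L(1, χ) ≤ (1 − β)(log q + ½)²/8`. [cite: Louboutin2006RelativeClassNumbers, Thm 1 (3) p. 200] -/
theorem LFunction_one_re_pos_and_le_of_zero_of_isPrimitive (hprim : χ.IsPrimitive) (hχ : χ ≠ 1)
    (hquad : χ.IsQuadratic) {β : ℝ} (hβ0 : 0 < β) (hβ1 : β < 1) (hzero : χ.LFunction β = 0) :
    0 < (χ.LFunction 1).re ∧ (χ.LFunction 1).re ≤ (1 - β) * (Real.log q + 1 / 2) ^ 2 / 8 :=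
  ⟨Siegel.LFunction_one_re_pos χ hχ hquad.sq_eq_one, (Complex.re_le_norm _).trans
    (norm_LFunction_one_le_of_zero_of_isPrimitive hprim hχ hquad hβ0 hβ1 hzero)⟩

end ParityFree

end Louboutin2001

end Literature.NumberTheory.LFunctions
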